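import Literature.NumberTheory.Automorphic.ArchTorusSmoothingGL2
import Literature.NumberTheory.Automorphic.ArchWhittakerPContinuityGL2
import Literature.NumberTheory.Automorphic.ArchKirillovMirabolicSchur
import Literature.NumberTheory.Automorphic.HilbertRepSchurGraphTwo
import Literature.NumberTheory.Automorphic.KirillovDilationGL2
import Literature.NumberTheory.Automorphic.MixedSpaceMomentKernelsFourier
import Literature.NumberTheory.Automorphic.ArchKirillovModelUnitary
import Literature.NumberTheory.Automorphic.AdelicGLnGlueProofs
import HarnessLib

/-!
# Jacquet–Shalika's Kirillov bound for `GL₂(K_∞)`: `∫_{K_∞ˣ} |W_v|² ≤ c ‖v‖²` — discharge of `JacquetShalika1981_archKirillovNorm_le 1 K`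

Topic `NumberTheory/Automorphic`; namespace `Literature.NumberTheory.Automorphic`. Definitions with
bodies and theorems (no named fact). Let `τ` be an irreducible unitary strongly continuous
representation of `GL₂(K_∞)` (`K_∞ = mixedSpace K`) on a Hilbert space `E` with Gårding space `𝒢`,
`ℓ` a continuous Whittaker functional on `𝒢` (`IsArchContWhittakerFunctional`) and
`W_v(u) = ℓ(τ(a(u)) v)`, `a(u) = diag(u, 1)`, the Kirillov function of `v ∈ 𝒢`
(`ArchKirillovFunctionGL2`). This file PROVES the rank-two case (`m = 1`) of the tree's named fact
`JacquetShalika1981_archKirillovNorm_le` (`ArchKirillovModelUnitary`; Jacquet–Shalika (1981), (3.16)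
Proposition p. 542, the inequality `∫_{N\P} |W|²(p) d_r p ≤ c ‖v‖²`):

  `JacquetShalika1981_archKirillovNorm_le_one : JacquetShalika1981_archKirillovNorm_le 1 K`.

The proof is classification-free and follows Jacquet–Shalika's §3 through the mirabolic subgroup
`P₂ = A U`, in four steps.

1. **Adjoint vectors** (`exists_norm_integral_mul_kirillovFn_le`). For a unipotent kernel
   `g ∈ C_c^∞(K_∞)` (`IsUnipKernel`) and a torus kernel `φ` (`IsTorusKernel`, `ArchTorusSmoothingGL2`)
   the doubly smoothed vectors `S_U(g) S_A(φ) v` stay in a class on which every `𝔭`-letter acts by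
   changing the kernels (`archDerivE_unipSmoothing_torusSmoothing`: absorption of `E₀₁ ⊗ b` into `g`,
   commutation of `E₀₀ ⊗ a` past `S_U(g)`, absorption into `φ` — `ArchUnipotentSmoothingGL2`,
   `ArchTorusSmoothingGL2`), so `‖τ(w) S_U(g) S_A(φ) v‖ ≤ C_w ‖v‖` for `𝔭`-words `w`; by the
   `P`-continuity of `ℓ` (`IsArchContWhittakerFunctional.norm_le_sum_pWords`, Jacquet–Shalika's
   Prop. (3.8) for `r = 2`, `ArchWhittakerPContinuityGL2`) and
   `ℓ(S_U(g) S_A(φ) v) = ĝ(1) ∫ φ W_v dμ`, the functional `v ↦ ∫ φ(u) W_v(u) dμ(u)` is bounded by a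
   multiple of `‖v‖` on `𝒢` for every torus kernel `φ`.
2. **Soft bound** (`memLp_kirillovFn`): `W_v ∈ L²(K_∞ˣ, μ)` for every `v ∈ 𝒢` and every left-invariant
   `μ` finite on compacts: `W_v(u) = ĝ₀(1)⁻¹ ℓ(S_U(g₀) τ(a(u)) v)` for a moment kernel `g₀` with
   `ĝ₀(1) ≠ 0`; `P`-continuity; pushing `𝔭`-words through `S_U` along the torus
   (`archWordDerivE_append_singleton_unipSmoothing_apply_diag`, one moment order per letter); and the
   dilation integral `∫ ‖S_U(g) τ(a(u)) v‖² dμ(u) ≤ (∫ |ĝ(z⁻¹)|² dμ) ‖v‖² < ∞`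
   (`lintegral_enorm_sq_unipSmoothing_apply_diag_le`: the unipotent line of `τ` is a unitary
   representation of `K_∞` with dilated matrix coefficients at `τ(a(y)) v`, so the abstract dilation
   integral `UnitaryRep.lintegral_weight_mul_norm_sq_integral_smul_le` applies; the constant is finite by
   `IsMomentKernel.lintegral_dilationConstant_lt_top`, for any Borel structure and any left-invariant
   `μ` by uniqueness of Haar measure).
3. **Closability and Schur** (`exists_norm_kirillovLp_le`): the graph `{(v, W_v)} ⊆ E × L²(μ)` is
   invariant under `P₂` acting by `τ|_{P₂}` and by the Kirillov representation `ρ` (`kirillovRep`,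
   covariance `kirillovFn_toArch_mirabolic`), `ρ` has the Schur property (`kirillovRep_schur`), and the
   closure of the graph is a graph because the adjoint vectors `\bar φ` of step 1 are total in `L²`
   (`Lp_eq_zero_of_forall_isTorusKernel`: characters times torus kernels, Fourier uniqueness on `K_∞ˣ`
   `ae_eq_zero_of_forall_integral_archChar_mul`, smooth bumps around every unit, countable subcover);
   the graph form of Schur's lemma (`ContRepresentation.exists_norm_snd_le_of_invariant_of_schur`,
   Wallach (1988), 1.2.2) gives `‖W_v‖_{L²(μ)} ≤ C ‖v‖` for a Haar measure `μ`.
4. **Transport** (`JacquetShalika1981_archKirillovNorm_le_one`): in the currency of the named fact the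
   integrand is `|W_v(y₀ det k)|²` (`cornerSucc_glDiagonal_one_mul`, torus weight `1`), the measure is
   Haar in `y₀` and finite in `k ∈ K_1` (compact), and the integral is `μK'(K_1) ∫ |W_v|² dν ≤ c ‖v‖²`
   (measurability-free: `lintegral_map_equiv`, `lintegral_prod_le`, right invariance).

## References

* H. Jacquet, J. A. Shalika, *On Euler products and the classification of automorphic
  representations I*, Amer. J. Math. 103 (1981), 499–558, §3: (3.1)–(3.5), Prop. (3.8) p. 522,
  (3.16) Proposition p. 542; §4 [JacquetShalikaAJM1981].
* N. R. Wallach, *Real Reductive Groups I* (1988), 1.2.2 [WallachRRG1].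
* G. B. Folland, *A Course in Abstract Harmonic Analysis* (1995), Thm. 4.44 [Folland1995].
* J. Arthur, L. Clozel, *Simple Algebras, Base Change, and the Advanced Theory of the Trace Formula*,
  Ann. of Math. Stud. 120 (1989), Ch. 3 §5 (where the archimedean estimate is consumed)
  [ArthurClozelAMS120].
-/

noncomputable section

open MeasureTheory Measure NumberField NumberField.mixedEmbedding NumberField.InfinitePlace IsDedekindDomain Set Filter Complex

open scoped MatrixGroups ENNReal NNReal Classical Topology ComplexConjugate Real ContDiff InnerProductSpace

namespace Literature.NumberTheory.Automorphic

variable {K : Type} [Field K] [NumberField K]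

-- as in `ArchUnipotentSmoothingGL2`
set_option backward.isDefEq.respectTransparency false

/-! ## Part A. Adjoint vectors of the Kirillov map -/

section AdjointVectors

attribute [local instance] glInfBorel borelSpace_glInf locallyCompactSpace_glInf secondCountableTopology_glInf


/-! ### 1. Unipotent kernels -/

section Kernel

/-- **Unipotent kernels**: smooth compactly supported functions on `K_∞`. [folklore] -/
structure IsUnipKernel (g : mixedSpace K → ℂ) : Prop where
  contDiff : ContDiff ℝ ∞ g
  hasCompactSupport : HasCompactSupport g

namespace IsUnipKernel

variable {g : mixedSpace K → ℂ}

/-- A unipotent kernel is continuous. [folklore] -/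
theorem continuous (hg : IsUnipKernel g) : Continuous g := hg.contDiff.continuous

/-- A unipotent kernel is `C¹`. [folklore] -/
theorem contDiff_one (hg : IsUnipKernel g) : ContDiff ℝ 1 g := hg.contDiff.of_le (by exact_mod_cast le_top)

/-- **Directional derivatives of unipotent kernels are unipotent kernels.** [folklore] -/
theorem fderivDir (hg : IsUnipKernel g) (b : mixedSpace K) : IsUnipKernel (fun x => -(fderiv ℝ g x b)) where
  contDiff := ((contDiff_infty_iff_fderiv.1 hg.contDiff).2.clm_apply contDiff_const).neg
  hasCompactSupport := (hg.hasCompactSupport.fderiv_apply (𝕜 := ℝ) b).neg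

/-- **`-∂_c (x_i g)` is a unipotent kernel** for a real coordinate `x_i`. [folklore] -/
theorem coordDeriv (hg : IsUnipKernel g) (i : index K) (c : mixedSpace K) :
    IsUnipKernel (fun x => -(fderiv ℝ (fun y => ((stdBasis K).repr y i : ℂ) * g y) x c)) := by
  have h : IsUnipKernel (fun y => ((stdBasis K).repr y i : ℂ) * g y) :=
    ⟨(Complex.ofRealCLM.contDiff.comp ((stdBasis K).coord i).toContinuousLinearMap.contDiff).mul hg.contDiff,
      hg.hasCompactSupport.mul_left⟩
  exact h.fderivDir c

end IsUnipKernel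

/-- **A unipotent kernel with `∫ g ψ_∞ ≠ 0` exists** (the tree's moment kernels with `ĝ(1) ≠ 0`,
`exists_isMomentKernelGE_kernelTransform_one_ne_zero`). [folklore] -/
theorem exists_isUnipKernel_integral_ne_zero :
    ∃ g : mixedSpace K → ℂ, IsUnipKernel g ∧ (∫ x, g x * archChar K 1 x) ≠ 0 := by
  obtain ⟨g, hg, hne⟩ := exists_isMomentKernelGE_kernelTransform_one_ne_zero (K := K) 0
  exact ⟨fun x => (g x : ℂ), ⟨Complex.ofRealCLM.contDiff.comp hg.contDiff, hg.hasCompactSupport.comp_left Complex.ofReal_zero⟩, hne⟩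

omit [NumberField K] in
/-- A letter of `𝔭` (vanishing second row) is `E₀₀ ⊗ X₀₀ + E₀₁ ⊗ X₀₁`. [folklore] -/
theorem eq_single00_add_single01 {X : Matrix (Fin 2) (Fin 2) (mixedSpace K)} (h10 : X 1 0 = 0) (h11 : X 1 1 = 0) :
    X = Matrix.single 0 0 (X 0 0) + Matrix.single 0 1 (X 0 1) := by
  refine Matrix.ext fun i j => ?_
  fin_cases i <;> fin_cases j
  · simp
  · simp
  · simpa using h10
  · simpa using h11

end Kernel

/-! ### 2. The letter step and the word bounds -/

section Smooth

variable {hcpt : isCompact_glFiniteIntegralLevel 2 K}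
  {E : Type*} [NormedAddCommGroup E] [NormedSpace ℂ E] [CompleteSpace E]
  {τ : ContRepresentation ℂ (AutomorphyDatum.gl 2 K hcpt).arch.carrier E}

/-- `τ(w)` is additive over finite sums of Gårding vectors. [folklore] -/
theorem archWordDerivE_finset_sum (hτ : τ.IsStronglyContinuous) {ι : Type*} (s : Finset ι) {f : ι → E}
    (hf : ∀ i ∈ s, f i ∈ archGardingSpace hcpt τ) (w : List (Matrix (Fin 2) (Fin 2) (mixedSpace K))) :
    archWordDerivE hcpt τ w (∑ i ∈ s, f i) = ∑ i ∈ s, archWordDerivE hcpt τ w (f i) := by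
  induction s using Finset.induction_on with
  | empty =>
    simp only [Finset.sum_empty]
    have h := archWordDerivE_smul hτ (0 : ℂ) (Submodule.zero_mem (archGardingSpace hcpt τ)) w
    rwa [zero_smul, zero_smul] at h
  | insert i s hi ih =>
    rw [Finset.sum_insert hi, Finset.sum_insert hi,
      archWordDerivE_add hτ (hf i (Finset.mem_insert_self i s)) (Submodule.sum_mem _ fun j hj => hf j (Finset.mem_insert_of_mem hj)) w,
      ih fun j hj => hf j (Finset.mem_insert_of_mem hj)]

variable [MeasurableSpace ((mixedSpace K)ˣ)] [BorelSpace ((mixedSpace K)ˣ)]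
  (μ : Measure (mixedSpace K)ˣ) [IsFiniteMeasureOnCompacts μ] [μ.IsMulLeftInvariant]

/-- **The letter step.** For a `𝔭`-letter `X` (`X₁₀ = X₁₁ = 0`), a unipotent kernel `g`, a torus kernel
`φ` and `v ∈ 𝒢`:
`τ(X) S_U(g) S_A(φ) v = S_U(g) S_A(φ_a) v + Σ_i S_U(-∂_{e_i a}(x_i g)) S_A(φ) v + S_U(-∂_b g) S_A(φ) v`,
`a = X₀₀`, `b = X₀₁`, `φ_a(x) = -∂φ(x)(a x)`. [cite: JacquetShalikaAJM1981, §3, (3.2)–(3.3)] -/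
theorem archDerivE_unipSmoothing_torusSmoothing (hτ : τ.IsStronglyContinuous) (hτb : ∀ g, ‖(τ g : E →L[ℂ] E)‖ ≤ 1)
    {g : mixedSpace K → ℂ} (hg : IsUnipKernel g) {φ : mixedSpace K → ℂ} (hφ : IsTorusKernel K φ)
    {X : Matrix (Fin 2) (Fin 2) (mixedSpace K)} (h10 : X 1 0 = 0) (h11 : X 1 1 = 0) {v : E} (hv : v ∈ archGardingSpace hcpt τ) :
    archDerivE hcpt τ X (unipSmoothing hcpt τ g (torusSmoothing hcpt τ μ φ v)) =
      unipSmoothing hcpt τ g (torusSmoothing hcpt τ μ (fun x => -(fderiv ℝ φ x (X 0 0 * x))) v) +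
        ∑ i, unipSmoothing hcpt τ (fun x => -(fderiv ℝ (fun y => ((stdBasis K).repr y i : ℂ) * g y) x (stdBasis K i * X 0 0)))
          (torusSmoothing hcpt τ μ φ v) +
        unipSmoothing hcpt τ (fun x => -(fderiv ℝ g x (X 0 1))) (torusSmoothing hcpt τ μ φ v) := by
  have hy : torusSmoothing hcpt τ μ φ v ∈ archGardingSpace hcpt τ :=
    torusSmoothing_mem_archGardingSpace μ hτ hτb hφ.continuous hφ.hasCompactSupport_comp_val hv
  have hSy : unipSmoothing hcpt τ g (torusSmoothing hcpt τ μ φ v) ∈ archGardingSpace hcpt τ :=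
    unipSmoothing_mem_archGardingSpace hτ hτb hg.continuous hg.hasCompactSupport hy
  conv_lhs => rw [eq_single00_add_single01 h10 h11]
  rw [archDerivE_add_dir hτ hSy, archDerivE_single00_unipSmoothing hτ hτb hg.contDiff_one hg.hasCompactSupport hy (X 0 0),
    archDerivE_single00_torusSmoothing μ hτ hτb hφ (X 0 0) v,
    archDerivE_single01_unipSmoothing hτ hτb hg.contDiff_one hg.hasCompactSupport (X 0 1)]

/-- **Word bounds**: for every `𝔭`-word `w`, unipotent kernel `g` and torus kernel `φ` there is `C`
with `‖τ(w) S_U(g) S_A(φ) v‖ ≤ C ‖v‖` for all `v ∈ 𝒢` (induction on `w` from the right with the letter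
step; the base case is `‖S_U(g) S_A(φ) v‖ ≤ ‖g‖₁ ‖φ‖₁ ‖v‖`). [cite: JacquetShalikaAJM1981, §3, proof of (3.16)] -/
theorem exists_norm_archWordDerivE_smoothing_le (hτ : τ.IsStronglyContinuous) (hτb : ∀ g, ‖(τ g : E →L[ℂ] E)‖ ≤ 1)
    (w : List (Matrix (Fin 2) (Fin 2) (mixedSpace K))) (hw : ∀ X ∈ w, X 1 0 = 0 ∧ X 1 1 = 0) :
    ∀ {g : mixedSpace K → ℂ} (_ : IsUnipKernel g) {φ : mixedSpace K → ℂ} (_ : IsTorusKernel K φ),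
      ∃ C : ℝ, ∀ v ∈ archGardingSpace hcpt τ,
        ‖archWordDerivE hcpt τ w (unipSmoothing hcpt τ g (torusSmoothing hcpt τ μ φ v))‖ ≤ C * ‖v‖ := by
  induction w using List.reverseRecOn with
  | nil =>
    intro g hg φ hφ
    refine ⟨(∫ x, ‖g x‖) * ∫ u, ‖φ (u : mixedSpace K)‖ ∂μ, fun v _ => ?_⟩
    rw [archWordDerivE_nil]
    calc ‖unipSmoothing hcpt τ g (torusSmoothing hcpt τ μ φ v)‖
          ≤ (∫ x, ‖g x‖) * ‖torusSmoothing hcpt τ μ φ v‖ := norm_unipSmoothing_le hτ hτb hg.continuous hg.hasCompactSupport _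
      _ ≤ (∫ x, ‖g x‖) * ((∫ u, ‖φ (u : mixedSpace K)‖ ∂μ) * ‖v‖) :=
          mul_le_mul_of_nonneg_left (norm_torusSmoothing_le μ hτ hτb hφ.continuous hφ.hasCompactSupport_comp_val v)
            (integral_nonneg fun _ => norm_nonneg _)
      _ = (∫ x, ‖g x‖) * (∫ u, ‖φ (u : mixedSpace K)‖ ∂μ) * ‖v‖ := by ring
  | append_singleton w X ih =>
    intro g hg φ hφ
    have hw' : ∀ Y ∈ w, Y 1 0 = 0 ∧ Y 1 1 = 0 := fun Y hY => hw Y (List.mem_append_left _ hY)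
    have hX : X 1 0 = 0 ∧ X 1 1 = 0 := hw X (List.mem_append_right _ (List.mem_singleton_self X))
    -- the three families of the letter step
    obtain ⟨C₁, hC₁⟩ := ih hw' hg (hφ.eulerDeriv (X 0 0))
    have h₂ : ∀ i, ∃ C : ℝ, ∀ v ∈ archGardingSpace hcpt τ,
        ‖archWordDerivE hcpt τ w (unipSmoothing hcpt τ
          (fun x => -(fderiv ℝ (fun y => ((stdBasis K).repr y i : ℂ) * g y) x (stdBasis K i * X 0 0))) (torusSmoothing hcpt τ μ φ v))‖ ≤ C * ‖v‖ :=
      fun i => ih hw' (hg.coordDeriv i _) hφ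
    choose C₂ hC₂ using h₂
    obtain ⟨C₃, hC₃⟩ := ih hw' (hg.fderivDir (X 0 1)) hφ
    refine ⟨C₁ + ∑ i, C₂ i + C₃, fun v hv => ?_⟩
    have hy : torusSmoothing hcpt τ μ φ v ∈ archGardingSpace hcpt τ :=
      torusSmoothing_mem_archGardingSpace μ hτ hτb hφ.continuous hφ.hasCompactSupport_comp_val hv
    have hmem : ∀ {g' : mixedSpace K → ℂ} (_ : IsUnipKernel g') {φ' : mixedSpace K → ℂ} (_ : IsTorusKernel K φ'),
        unipSmoothing hcpt τ g' (torusSmoothing hcpt τ μ φ' v) ∈ archGardingSpace hcpt τ := fun {g'} hg' {φ'} hφ' =>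
      unipSmoothing_mem_archGardingSpace hτ hτb hg'.continuous hg'.hasCompactSupport
        (torusSmoothing_mem_archGardingSpace μ hτ hτb hφ'.continuous hφ'.hasCompactSupport_comp_val hv)
    rw [archWordDerivE_append [X] _ w, archWordDerivE_cons, archWordDerivE_nil,
      archDerivE_unipSmoothing_torusSmoothing μ hτ hτb hg hφ hX.1 hX.2 hv,
      archWordDerivE_add hτ (Submodule.add_mem _ (hmem hg (hφ.eulerDeriv _)) (Submodule.sum_mem _ fun i _ => hmem (hg.coordDeriv i _) hφ))
        (hmem (hg.fderivDir _) hφ) w,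
      archWordDerivE_add hτ (hmem hg (hφ.eulerDeriv _)) (Submodule.sum_mem _ fun i _ => hmem (hg.coordDeriv i _) hφ) w,
      archWordDerivE_finset_sum hτ _ (fun i _ => hmem (hg.coordDeriv i _) hφ) w]
    calc _ ≤ ‖archWordDerivE hcpt τ w (unipSmoothing hcpt τ g (torusSmoothing hcpt τ μ (fun x => -(fderiv ℝ φ x (X 0 0 * x))) v))‖ +
          ‖∑ i, archWordDerivE hcpt τ w (unipSmoothing hcpt τ
            (fun x => -(fderiv ℝ (fun y => ((stdBasis K).repr y i : ℂ) * g y) x (stdBasis K i * X 0 0))) (torusSmoothing hcpt τ μ φ v))‖ +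
          ‖archWordDerivE hcpt τ w (unipSmoothing hcpt τ (fun x => -(fderiv ℝ g x (X 0 1))) (torusSmoothing hcpt τ μ φ v))‖ :=
          (norm_add_le _ _).trans (add_le_add (norm_add_le _ _) le_rfl)
      _ ≤ C₁ * ‖v‖ + (∑ i, C₂ i * ‖v‖) + C₃ * ‖v‖ := by
          refine add_le_add (add_le_add (hC₁ v hv) ((norm_sum_le _ _).trans (Finset.sum_le_sum fun i _ => hC₂ i v hv))) (hC₃ v hv)
      _ = (C₁ + ∑ i, C₂ i + C₃) * ‖v‖ := by rw [← Finset.sum_mul]; ring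

end Smooth

/-! ### 3. Whittaker functionals: `E`-boundedness and identification -/

section Whittaker

variable {hcpt : isCompact_glFiniteIntegralLevel 2 K}
  {E : Type*} [NormedAddCommGroup E] [InnerProductSpace ℂ E] [CompleteSpace E]
  {τ : ContRepresentation ℂ (AutomorphyDatum.gl 2 K hcpt).arch.carrier E}

/-- A unitary representation acts by operators of norm `≤ 1`. [folklore] -/
theorem norm_apply_le_one_of_isUnitary (hτu : τ.IsUnitary) (g : (AutomorphyDatum.gl 2 K hcpt).arch.carrier) :
    ‖(τ g : E →L[ℂ] E)‖ ≤ 1 :=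
  ContinuousLinearMap.opNorm_le_bound _ zero_le_one fun x => by rw [hτu.norm_map, one_mul]

variable [MeasurableSpace ((mixedSpace K)ˣ)] [BorelSpace ((mixedSpace K)ˣ)]
  (μ : Measure (mixedSpace K)ˣ) [IsFiniteMeasureOnCompacts μ]

/-- **`E`-boundedness of `v ↦ ℓ(S_U(g) S_A(φ) v)` on the Gårding space** of an irreducible unitary
representation, for a continuous Whittaker functional `ℓ`: by the `P`-continuity
`‖ℓ x‖ ≤ C Σ_{w ∈ 𝒮'} ‖τ(w) x‖` over `𝔭`-words (Jacquet–Shalika (1981), Prop. (3.8)) and the word bounds.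
[cite: JacquetShalikaAJM1981, §3, Prop. (3.8) and (3.16)] -/
theorem exists_norm_apply_smoothing_le [μ.IsMulLeftInvariant] {hτ : τ.IsStronglyContinuous}
    {ℓ : archGardingSpace hcpt τ →ₗ[ℂ] ℂ} (hℓ : IsArchContWhittakerFunctional hcpt τ hτ ℓ)
    (hτu : τ.IsUnitary) (hτi : τ.IsTopIrreducible)
    {g : mixedSpace K → ℂ} (hg : IsUnipKernel g) {φ : mixedSpace K → ℂ} (hφ : IsTorusKernel K φ) :
    ∃ C : ℝ, ∀ (v : E) (hv : v ∈ archGardingSpace hcpt τ),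
      ‖ℓ ⟨unipSmoothing hcpt τ g (torusSmoothing hcpt τ μ φ v),
        unipSmoothing_mem_archGardingSpace hτ (norm_apply_le_one_of_isUnitary hτu) hg.continuous hg.hasCompactSupport
          (torusSmoothing_mem_archGardingSpace μ hτ (norm_apply_le_one_of_isUnitary hτu) hφ.continuous
            hφ.hasCompactSupport_comp_val hv)⟩‖ ≤ C * ‖v‖ := by
  have hτb : ∀ g, ‖(τ g : E →L[ℂ] E)‖ ≤ 1 := norm_apply_le_one_of_isUnitary hτu
  obtain ⟨C, 𝒮', hC, h𝒮', hbound⟩ := hℓ.norm_le_sum_pWords hτu hτi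
  have hw : ∀ w ∈ 𝒮', ∃ Cw : ℝ, ∀ v ∈ archGardingSpace hcpt τ,
      ‖archWordDerivE hcpt τ w (unipSmoothing hcpt τ g (torusSmoothing hcpt τ μ φ v))‖ ≤ Cw * ‖v‖ :=
    fun w hw => exists_norm_archWordDerivE_smoothing_le μ hτ hτb w (h𝒮' w hw) hg hφ
  choose! Cw hCw using hw
  refine ⟨C * ∑ w ∈ 𝒮', Cw w, fun v hv => ?_⟩
  refine (hbound _).trans ?_
  rw [Finset.mul_sum, Finset.mul_sum, Finset.sum_mul]
  refine Finset.sum_le_sum fun w hw' => ?_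
  rw [mul_assoc]
  exact mul_le_mul_of_nonneg_left (hCw w hw' v hv) hC

/-- **Identification**: `ℓ(S_U(g) S_A(φ) v) = (∫ g ψ_∞) · ∫ φ(u) W_v(u) dμ(u)` for `v ∈ 𝒢`
(`apply_unipSmoothing_eq` and `apply_torusSmoothing_eq`). [cite: JacquetShalikaAJM1981, §3, (3.3) and (3.16)] -/
theorem apply_smoothing_eq (hτu : ∀ g, ‖(τ g : E →L[ℂ] E)‖ ≤ 1) {hτ : τ.IsStronglyContinuous}
    {ℓ : archGardingSpace hcpt τ →ₗ[ℂ] ℂ} (hℓ : IsArchContWhittakerFunctional hcpt τ hτ ℓ)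
    {g : mixedSpace K → ℂ} (hgc : Continuous g) (hgs : HasCompactSupport g)
    {φ : mixedSpace K → ℂ} (hφc : Continuous φ) (hφs : HasCompactSupport fun u : (mixedSpace K)ˣ => φ (u : mixedSpace K))
    (v : archGardingSpace hcpt τ) :
    ℓ ⟨unipSmoothing hcpt τ g (torusSmoothing hcpt τ μ φ v),
        unipSmoothing_mem_archGardingSpace hτ hτu hgc hgs (torusSmoothing_mem_archGardingSpace μ hτ hτu hφc hφs v.2)⟩ =
      (∫ x, g x * archChar K 1 x) * ∫ u, φ (u : mixedSpace K) * kirillovFn hτ ℓ v u ∂μ := by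
  rw [apply_unipSmoothing_eq hτu hℓ hgc hgs (torusSmoothing_mem_archGardingSpace μ hτ hτu hφc hφs v.2)]
  congr 1
  exact apply_torusSmoothing_eq μ hτu hτ hℓ.norm_le hφc hφs v

/-- **The adjoint vectors of the Kirillov map.** For every torus kernel `φ` the functional
`v ↦ ∫ φ(u) W_v(u) dμ(u)` is bounded by a multiple of `‖v‖` on the Gårding space of an irreducible
unitary representation with a continuous Whittaker functional. [cite: JacquetShalikaAJM1981, §3, (3.16)] -/
theorem exists_norm_integral_mul_kirillovFn_le [μ.IsMulLeftInvariant] {hτ : τ.IsStronglyContinuous}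
    {ℓ : archGardingSpace hcpt τ →ₗ[ℂ] ℂ} (hℓ : IsArchContWhittakerFunctional hcpt τ hτ ℓ)
    (hτu : τ.IsUnitary) (hτi : τ.IsTopIrreducible) {φ : mixedSpace K → ℂ} (hφ : IsTorusKernel K φ) :
    ∃ C : ℝ, ∀ v : archGardingSpace hcpt τ, ‖∫ u, φ (u : mixedSpace K) * kirillovFn hτ ℓ v u ∂μ‖ ≤ C * ‖(v : E)‖ := by
  obtain ⟨g, hg, hne⟩ := exists_isUnipKernel_integral_ne_zero (K := K)
  obtain ⟨C, hC⟩ := exists_norm_apply_smoothing_le μ hℓ hτu hτi hg hφ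
  refine ⟨‖∫ x, g x * archChar K 1 x‖⁻¹ * C, fun v => ?_⟩
  have h := hC (v : E) v.2
  rw [apply_smoothing_eq μ (norm_apply_le_one_of_isUnitary hτu) hℓ hg.continuous hg.hasCompactSupport hφ.continuous
    hφ.hasCompactSupport_comp_val v, norm_mul] at h
  have hpos : 0 < ‖∫ x, g x * archChar K 1 x‖ := norm_pos_iff.2 hne
  rw [mul_assoc, le_inv_mul_iff₀ hpos]
  exact h

end Whittaker

end AdjointVectors

/-! ## Part B. The Kirillov functions of Gårding vectors are square integrable -/

section SoftBound

open Literature.Analysis.UnboundedOperators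

attribute [local instance] glInfBorel borelSpace_glInf locallyCompactSpace_glInf secondCountableTopology_glInf


/-! ### 1. The unipotent line as a unitary representation of `K_∞`; dilated matrix coefficients -/

section Line

variable {hcpt : isCompact_glFiniteIntegralLevel 2 K}
  {E : Type*} [NormedAddCommGroup E] [InnerProductSpace ℂ E] [CompleteSpace E]
  {τ : ContRepresentation ℂ (AutomorphyDatum.gl 2 K hcpt).arch.carrier E}

omit [NumberField K] in
/-- `n(0) = 1`. [folklore] -/
theorem unipGL_zero : unipGL K 0 = 1 := by
  change ((unipotentGL2 (0 : mixedSpace K) : ↥(upperUnitriangular (Fin 2) (mixedSpace K))) : GL (Fin 2) (mixedSpace K)) = 1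
  rw [unipotentGL2_zero]; rfl

variable (hcpt) in
/-- **`x ↦ n(x)` as a continuous homomorphism** from the additive group `K_∞` into `G_∞ = GL₂(K_∞)`.
[folklore] -/
def unipHom : Multiplicative (mixedSpace K) →ₜ* (AutomorphyDatum.gl 2 K hcpt).arch.carrier where
  toFun x := toArch hcpt (unipGL K x.toAdd)
  map_one' := Subtype.ext (by change unipGL K 0 = 1; exact unipGL_zero)
  map_mul' x y := Subtype.ext (by change unipGL K (x.toAdd + y.toAdd) = unipGL K x.toAdd * unipGL K y.toAdd; exact unipGL_add _ _)
  continuous_toFun := (continuous_unipGL.comp continuous_toAdd).subtype_mk _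

/-- **The unipotent line of `τ`**: the unitary representation `x ↦ τ(n(x))` of the additive group
`K_∞`. [cite: JacquetShalikaAJM1981, §4] -/
def unipLineRep (hτ : τ.IsStronglyContinuous) (hτu : τ.IsUnitary) : UnitaryRep (Multiplicative (mixedSpace K)) E :=
  (τ.toUnitaryRep hτ hτu).restrict (unipHom hcpt)

/-- `unipLineRep (ofAdd x) = τ(n(x))`. [folklore] -/
@[simp] theorem unipLineRep_apply (hτ : τ.IsStronglyContinuous) (hτu : τ.IsUnitary) (x : mixedSpace K) :
    unipLineRep hτ hτu (Multiplicative.ofAdd x) = τ (toArch hcpt (unipGL K x)) := rfl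

omit [NumberField K] in
/-- `a(y)⁻¹ n(x) a(y) = n(y⁻¹ x)`. [folklore] -/
theorem diagGL2_inv_mul_unipGL_mul_diagGL2 (y : (mixedSpace K)ˣ) (x : mixedSpace K) :
    (diagGL2 y (1 : (mixedSpace K)ˣ))⁻¹ * unipGL K x * diagGL2 y 1 = unipGL K (((y⁻¹ : (mixedSpace K)ˣ) : mixedSpace K) * x) := by
  have h := diagGL2_inv_mul_unipotentGL2_mul_diagGL2 (R := mixedSpace K) y 1 x
  rw [Units.val_one, mul_one] at h
  exact h

/-- **Matrix coefficients at a torus translate are the dilated ones**: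
`⟪τ(a(y)) v, τ(n(x)) τ(a(y)) v⟫ = ⟪v, τ(n(y⁻¹ x)) v⟫`. [cite: JacquetShalikaAJM1981, §4] -/
theorem matrixCoeff_apply_diag (hτ : τ.IsStronglyContinuous) (hτu : τ.IsUnitary) (y : (mixedSpace K)ˣ) (v : E) (x : mixedSpace K) :
    (unipLineRep hτ hτu).matrixCoeff (τ (toArch hcpt (diagGL2 y 1)) v) (τ (toArch hcpt (diagGL2 y 1)) v) x =
      (unipLineRep hτ hτu).matrixCoeff v v (mixedMulAct K y⁻¹ x) := by
  rw [UnitaryRep.matrixCoeff_apply, UnitaryRep.matrixCoeff_apply, unipLineRep_apply, unipLineRep_apply, mixedMulAct_apply]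
  have hconj : τ (toArch hcpt (unipGL K x)) (τ (toArch hcpt (diagGL2 y 1)) v) =
      τ (toArch hcpt (diagGL2 y 1)) (τ (toArch hcpt (unipGL K (((y⁻¹ : (mixedSpace K)ˣ) : mixedSpace K) * x))) v) := by
    rw [← ContinuousLinearMap.comp_apply, ← ContinuousLinearMap.mul_def, ← map_mul,
      ← ContinuousLinearMap.comp_apply (τ (toArch hcpt (diagGL2 y 1))), ← ContinuousLinearMap.mul_def, ← map_mul]
    congr 2
    refine Subtype.ext ?_
    change unipGL K x * diagGL2 y 1 = diagGL2 y 1 * unipGL K (((y⁻¹ : (mixedSpace K)ˣ) : mixedSpace K) * x)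
    rw [← diagGL2_inv_mul_unipGL_mul_diagGL2, ← mul_assoc, ← mul_assoc, mul_inv_cancel, one_mul]
  rw [hconj, hτu.inner_map_map]

end Line

/-! ### 2. The dilation integral for `S_U(g) τ(a(u)) v` -/

section Dilation

variable {hcpt : isCompact_glFiniteIntegralLevel 2 K}
  {E : Type*} [NormedAddCommGroup E] [InnerProductSpace ℂ E] [CompleteSpace E]
  {τ : ContRepresentation ℂ (AutomorphyDatum.gl 2 K hcpt).arch.carrier E}

/-- **Finiteness of the dilation constant for any left-invariant measure**: for a moment kernel `g`
with at least one pure derivative at every place, `∫_{K_∞ˣ} |ĝ(z⁻¹)|² dμ(z) < ∞` for every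
left-invariant Borel measure `μ` on `K_∞ˣ` finite on compacts (the tree's
`IsMomentKernel.lintegral_dilationConstant_lt_top` for `d^×z`, uniqueness of Haar measure, and
independence of the Borel structure). [cite: JacquetShalikaAJM1981, §4] -/
theorem lintegral_ofReal_norm_sq_kernelTransform_inv_lt_top [inst : MeasurableSpace ((mixedSpace K)ˣ)] [BorelSpace ((mixedSpace K)ˣ)]
    (μ : Measure (mixedSpace K)ˣ) [IsFiniteMeasureOnCompacts μ] [μ.IsMulLeftInvariant]
    {k : InfinitePlace K → ℕ} {g : mixedSpace K → ℝ} (hg : IsMomentKernel K k g) (hk : ∀ w, 1 ≤ k w) :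
    ∫⁻ z, ENNReal.ofReal (‖kernelTransform K g (((z⁻¹ : (mixedSpace K)ˣ) : mixedSpace K))‖ ^ 2) ∂μ < ⊤ := by
  have hinst : inst = Units.instMeasurableSpace :=
    (BorelSpace.measurable_eq (α := (mixedSpace K)ˣ)).trans
      (@BorelSpace.measurable_eq _ _ Units.instMeasurableSpace
        (Literature.MeasureTheory.Group.Units.borelSpace_of_isOpenEmbedding (A := mixedSpace K))).symm
  subst hinst
  have h := hg.lintegral_dilationConstant_lt_top (m := 0) (fun w => by simpa using hk w)
  simp only [smul_zero, placeWeight, Pi.zero_apply, pow_zero, Finset.prod_const_one, one_mul] at h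
  rw [Measure.isMulLeftInvariant_eq_smul μ (mixedUnitsHaar K), lintegral_smul_measure, ENNReal.smul_def, smul_eq_mul]
  exact ENNReal.mul_lt_top ENNReal.coe_lt_top h

variable [MeasurableSpace ((mixedSpace K)ˣ)] [BorelSpace ((mixedSpace K)ˣ)]
  (μ : Measure (mixedSpace K)ˣ) [IsFiniteMeasureOnCompacts μ] [μ.IsMulLeftInvariant]

/-- **The dilation integral**: for a moment kernel `g` of order `≥ 1` at every place and any `v ∈ E`,
`∫ ‖S_U(g) τ(a(u)) v‖² dμ(u) ≤ (∫ |ĝ(z⁻¹)|² dμ(z)) ‖v‖²` (the abstract dilation integral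
`UnitaryRep.lintegral_weight_mul_norm_sq_integral_smul_le` with trivial weights, for the unipotent
line of `τ`; `ĝ` vanishes off the units). [cite: JacquetShalikaAJM1981, §4] [cite: Folland1995, Thm. 4.44] -/
theorem lintegral_enorm_sq_unipSmoothing_apply_diag_le (hτ : τ.IsStronglyContinuous) (hτu : τ.IsUnitary)
    {k : InfinitePlace K → ℕ} {g : mixedSpace K → ℝ} (hg : IsMomentKernel K k g) (hk : ∀ w, 1 ≤ k w) (v : E) :
    ∫⁻ y, ‖unipSmoothing hcpt τ (fun x => (g x : ℂ)) (τ (toArch hcpt (diagGL2 y 1)) v)‖ₑ ^ 2 ∂μ ≤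
      (∫⁻ z, ENNReal.ofReal (‖kernelTransform K g (((z⁻¹ : (mixedSpace K)ˣ) : mixedSpace K))‖ ^ 2) ∂μ) * ENNReal.ofReal (‖v‖ ^ 2) := by
  have hgi : Integrable (fun x => (g x : ℂ)) (volume : Measure (mixedSpace K)) :=
    (hg.continuous.integrable_of_hasCompactSupport hg.hasCompactSupport).ofReal
  have h := (unipLineRep hτ hτu).lintegral_weight_mul_norm_sq_integral_smul_le (archCharForm K)
    archCharForm_nondegenerate (mixedMulAct K) (continuous_mixedMulAct_inv_uncurry.measurable)
    (fun y ξ x => archCharForm_mixedMulAct y ξ x) v (fun y => τ (toArch hcpt (diagGL2 y 1)) v)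
    (fun y x => matrixCoeff_apply_diag hτ hτu y v x) μ (fun _ => 1) measurable_const (fun _ _ => (one_mul _).symm)
    (fun _ => 1) measurable_const 1 (fun _ _ => (one_mul _).symm) rfl (volume : Measure (mixedSpace K)) hgi
    (fun ξ hξ => by
      have h0 := hg.kernelTransform_eq_zero_of_not_isUnit hk (mt (mem_range_mixedMulAct_one_iff ξ).2 hξ)
      rwa [kernelTransform_eq] at h0)
  simp only [one_mul, lintegral_one, unipLineRep_apply, mixedMulAct_apply, mul_one, UnitaryRep.spectralMeasure_univ] at h
  have hL : ∀ y : (mixedSpace K)ˣ, ‖unipSmoothing hcpt τ (fun x => (g x : ℂ)) (τ (toArch hcpt (diagGL2 y 1)) v)‖ₑ ^ 2 =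
      ENNReal.ofReal (‖∫ x, (g x : ℂ) • τ (toArch hcpt (unipGL K x)) (τ (toArch hcpt (diagGL2 y 1)) v)‖ ^ 2) := by
    intro y
    rw [← ofReal_norm, ← ENNReal.ofReal_pow (norm_nonneg _)]
    rfl
  have hR : ∀ z : (mixedSpace K)ˣ, ENNReal.ofReal (‖kernelTransform K g (((z⁻¹ : (mixedSpace K)ˣ) : mixedSpace K))‖ ^ 2) =
      ENNReal.ofReal (‖∫ x, (g x : ℂ) * cexp ((archCharForm K (((z⁻¹ : (mixedSpace K)ˣ) : mixedSpace K)) x : ℝ) * I)‖ ^ 2) := by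
    intro z; rw [kernelTransform_eq]
  simp_rw [hL, hR]
  exact h

/-- **`S_U(g)` as a bounded operator** on `E` (for `‖τ(·)‖ ≤ 1`). [folklore] -/
def unipSmoothingL (hτ : τ.IsStronglyContinuous) (hτb : ∀ g, ‖(τ g : E →L[ℂ] E)‖ ≤ 1) {g : mixedSpace K → ℂ}
    (hg : Continuous g) (hgs : HasCompactSupport g) : E →L[ℂ] E :=
  LinearMap.mkContinuous
    { toFun := unipSmoothing hcpt τ g
      map_add' := unipSmoothing_add_vec hτ hg hgs
      map_smul' := fun c v => unipSmoothing_smul_vec g c v }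
    (∫ x, ‖g x‖) fun v => norm_unipSmoothing_le hτ hτb hg hgs v

omit [CompleteSpace E] [MeasurableSpace ((mixedSpace K)ˣ)] [BorelSpace ((mixedSpace K)ˣ)] in
/-- Unfolding of `unipSmoothingL`. [folklore] -/
@[simp] theorem unipSmoothingL_apply (hτ : τ.IsStronglyContinuous) (hτb : ∀ g, ‖(τ g : E →L[ℂ] E)‖ ≤ 1) {g : mixedSpace K → ℂ}
    (hg : Continuous g) (hgs : HasCompactSupport g) (v : E) : unipSmoothingL hτ hτb hg hgs v = unipSmoothing hcpt τ g v := rfl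

omit [CompleteSpace E] [MeasurableSpace ((mixedSpace K)ˣ)] [BorelSpace ((mixedSpace K)ˣ)] in
/-- `S_U(g)` is continuous on `E`. [folklore] -/
theorem continuous_unipSmoothing (hτ : τ.IsStronglyContinuous) (hτb : ∀ g, ‖(τ g : E →L[ℂ] E)‖ ≤ 1) {g : mixedSpace K → ℂ}
    (hg : Continuous g) (hgs : HasCompactSupport g) : Continuous (unipSmoothing hcpt τ g : E → E) := by
  have h : (unipSmoothing hcpt τ g : E → E) = unipSmoothingL hτ hτb hg hgs := by
    funext v; rw [unipSmoothingL_apply]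
  rw [h]; exact (unipSmoothingL hτ hτb hg hgs).continuous

/-- **Base case: `u ↦ S_U(g) τ(a(u)) v` is square integrable** for a moment kernel `g` of order `≥ 1`
and any `v ∈ E`. [cite: JacquetShalikaAJM1981, §4] -/
theorem memLp_unipSmoothing_apply_diag (hτ : τ.IsStronglyContinuous) (hτu : τ.IsUnitary)
    {g : mixedSpace K → ℝ} (hg : IsMomentKernelGE K 1 g) (v : E) :
    MemLp (fun u : (mixedSpace K)ˣ => unipSmoothing hcpt τ (fun x => (g x : ℂ)) (τ (toArch hcpt (diagGL2 u 1)) v)) 2 μ := by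
  obtain ⟨k, hk, hgk⟩ := hg
  have hτb := norm_apply_le_one_of_isUnitary (hcpt := hcpt) hτu
  have hgc : Continuous fun x => (g x : ℂ) := continuous_ofReal.comp hgk.continuous
  have hgs : HasCompactSupport fun x => (g x : ℂ) := hgk.hasCompactSupport.comp_left Complex.ofReal_zero
  have hcont : Continuous fun u : (mixedSpace K)ˣ => unipSmoothing hcpt τ (fun x => (g x : ℂ)) (τ (toArch hcpt (diagGL2 u 1)) v) :=
    (continuous_unipSmoothing hτ hτb hgc hgs).comp ((continuous_apply_toArch hcpt τ hτ v).comp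
      (continuous_diagGL2.comp (continuous_id.prodMk continuous_const)))
  rw [memLp_two_iff_integrable_sq_norm hcont.aestronglyMeasurable]
  refine ⟨(hcont.norm.pow 2).aestronglyMeasurable, ?_⟩
  rw [hasFiniteIntegral_iff_enorm]
  have heq : ∀ u : (mixedSpace K)ˣ, ‖‖unipSmoothing hcpt τ (fun x => (g x : ℂ)) (τ (toArch hcpt (diagGL2 u 1)) v)‖ ^ 2‖ₑ =
      ‖unipSmoothing hcpt τ (fun x => (g x : ℂ)) (τ (toArch hcpt (diagGL2 u 1)) v)‖ₑ ^ 2 := by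
    intro u
    rw [Real.enorm_eq_ofReal (sq_nonneg _), ENNReal.ofReal_pow (norm_nonneg _), ofReal_norm]
  simp_rw [heq]
  refine lt_of_le_of_lt (lintegral_enorm_sq_unipSmoothing_apply_diag_le μ hτ hτu hgk hk v) ?_
  exact ENNReal.mul_lt_top (lintegral_ofReal_norm_sq_kernelTransform_inv_lt_top μ hgk hk) ENNReal.ofReal_lt_top

end Dilation

/-! ### 3. Pushing `𝔭`-words through `S_U(g)` along the torus -/

section Push

variable {hcpt : isCompact_glFiniteIntegralLevel 2 K}
  {E : Type*} [NormedAddCommGroup E] [InnerProductSpace ℂ E] [CompleteSpace E]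
  {τ : ContRepresentation ℂ (AutomorphyDatum.gl 2 K hcpt).arch.carrier E}

/-- The kernel `-∂_b g`. [folklore] -/
def dirDerivKernel (g : mixedSpace K → ℝ) (b : mixedSpace K) : mixedSpace K → ℝ := -fun y => fderiv ℝ g y b

/-- The kernel `-∂_c (x_i g)` for a real coordinate `x_i`. [folklore] -/
def coordDerivKernel (g : mixedSpace K → ℝ) (i : index K) (c : mixedSpace K) : mixedSpace K → ℝ :=
  -fun y => fderiv ℝ (fun y => (stdBasis K).repr y i * g y) y c

/-- `-∂_b g` keeps the order of a moment kernel. [folklore] -/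
theorem IsMomentKernelGE.dirDerivKernel {M : ℕ} {g : mixedSpace K → ℝ} (hg : IsMomentKernelGE K M g) (b : mixedSpace K) :
    IsMomentKernelGE K M (dirDerivKernel g b) :=
  (hg.fderiv_dir b).neg

/-- `-∂_c (x_i g)` loses one order of a moment kernel. [folklore] -/
theorem IsMomentKernelGE.coordDerivKernel {M : ℕ} {g : mixedSpace K → ℝ} (hg : IsMomentKernelGE K (M + 1) g) (i : index K) (c : mixedSpace K) :
    IsMomentKernelGE K M (coordDerivKernel g i c) :=
  ((hg.coord_mul i).fderiv_dir c).neg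

/-- `-∂_b` of a real kernel read in `ℂ`. [folklore] -/
theorem neg_fderiv_ofReal_comp {g : mixedSpace K → ℝ} (hg : Differentiable ℝ g) (b : mixedSpace K) :
    (fun x => -(fderiv ℝ (fun x => (g x : ℂ)) x b)) = fun x => ((dirDerivKernel g b x : ℝ) : ℂ) := by
  funext x
  rw [fderiv_ofReal_comp_apply (K := K) hg x b, dirDerivKernel, Pi.neg_apply, ofReal_neg]

/-- `-∂_c (x_i g)` of a real kernel read in `ℂ`. [folklore] -/
theorem neg_fderiv_coord_mul_ofReal_comp {g : mixedSpace K → ℝ} (hg : Differentiable ℝ g) (i : index K) (c : mixedSpace K) :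
    (fun x => -(fderiv ℝ (fun y => ((stdBasis K).repr y i : ℂ) * (g y : ℂ)) x c)) = fun x => ((coordDerivKernel g i c x : ℝ) : ℂ) := by
  have h1 : (fun y => ((stdBasis K).repr y i : ℂ) * (g y : ℂ)) = fun y => (((stdBasis K).repr y i * g y : ℝ) : ℂ) := by
    funext y; rw [ofReal_mul]
  have hd : Differentiable ℝ fun y => (stdBasis K).repr y i * g y :=
    ((stdBasis K).coord i).toContinuousLinearMap.differentiable.mul hg
  funext x
  rw [h1, fderiv_ofReal_comp_apply (K := K) hd x c, coordDerivKernel, Pi.neg_apply, ofReal_neg]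

omit [NumberField K] in
/-- `Ad(a(u)) (E₀₀ ⊗ a) = E₀₀ ⊗ a`. [folklore] -/
theorem diagGL2_mul_single00_mul_inv (u : (mixedSpace K)ˣ) (a : mixedSpace K) :
    ((diagGL2 u (1 : (mixedSpace K)ˣ) : GL (Fin 2) (mixedSpace K)) : Matrix (Fin 2) (Fin 2) (mixedSpace K)) * Matrix.single 0 0 a *
      (((diagGL2 u (1 : (mixedSpace K)ˣ))⁻¹ : GL (Fin 2) (mixedSpace K)) : Matrix (Fin 2) (Fin 2) (mixedSpace K)) = Matrix.single 0 0 a := by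
  have hu : ∀ b : mixedSpace K, (u : mixedSpace K) * b * ((u⁻¹ : (mixedSpace K)ˣ) : mixedSpace K) = b := fun b => by
    rw [mul_comm _ b, mul_assoc, Units.mul_inv, mul_one]
  rw [diagGL2_inv, inv_one, coe_diagGL2, coe_diagGL2]
  refine Matrix.ext fun i j => ?_
  simp only [Matrix.mul_apply, Fin.sum_univ_two]
  fin_cases i <;> fin_cases j <;> simp [-Units.val_inv_eq_inv_val, hu]

/-- **Diagonal letters commute with the torus**: `τ(E₀₀ ⊗ a) τ(a(u)) v = τ(a(u)) τ(E₀₀ ⊗ a) v` for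
`v ∈ 𝒢`. [folklore] -/
theorem archDerivE_single00_apply_diag (hτ : τ.IsStronglyContinuous) {v : E} (hv : v ∈ archGardingSpace hcpt τ)
    (u : (mixedSpace K)ˣ) (a : mixedSpace K) :
    archDerivE hcpt τ (Matrix.single 0 0 a) (τ (toArch hcpt (diagGL2 u 1)) v) =
      τ (toArch hcpt (diagGL2 u 1)) (archDerivE hcpt τ (Matrix.single 0 0 a) v) := by
  have h := apply_toArch_archDerivE hτ hv (diagGL2 u 1) (Matrix.single 0 0 a)
  rw [diagGL2_mul_single00_mul_inv] at h
  exact h.symm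

/-- **One letter on `S_U(g) τ(a(u)) v`**: for a `𝔭`-letter `X` and a real `C¹` kernel `g` of compact
support, `τ(X) S_U(g) τ(a(u)) v = S_U(g) τ(a(u)) τ(E₀₀⊗a) v + Σ_i S_U(-∂_{e_i a}(x_i g)) τ(a(u)) v
+ S_U(-∂_b g) τ(a(u)) v`, `a = X₀₀`, `b = X₀₁`. [cite: JacquetShalikaAJM1981, §3, (3.2)–(3.3)] -/
theorem archDerivE_unipSmoothing_apply_diag (hτ : τ.IsStronglyContinuous) (hτb : ∀ g, ‖(τ g : E →L[ℂ] E)‖ ≤ 1)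
    {X : Matrix (Fin 2) (Fin 2) (mixedSpace K)} (h10 : X 1 0 = 0) (h11 : X 1 1 = 0)
    {g : mixedSpace K → ℝ} (hg : ContDiff ℝ 1 g) (hgs : HasCompactSupport g) {v : E} (hv : v ∈ archGardingSpace hcpt τ) (u : (mixedSpace K)ˣ) :
    archDerivE hcpt τ X (unipSmoothing hcpt τ (fun x => (g x : ℂ)) (τ (toArch hcpt (diagGL2 u 1)) v)) =
      unipSmoothing hcpt τ (fun x => (g x : ℂ)) (τ (toArch hcpt (diagGL2 u 1)) (archDerivE hcpt τ (Matrix.single 0 0 (X 0 0)) v)) +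
        ∑ i, unipSmoothing hcpt τ (fun x => ((coordDerivKernel g i (stdBasis K i * X 0 0) x : ℝ) : ℂ)) (τ (toArch hcpt (diagGL2 u 1)) v) +
        unipSmoothing hcpt τ (fun x => ((dirDerivKernel g (X 0 1) x : ℝ) : ℂ)) (τ (toArch hcpt (diagGL2 u 1)) v) := by
  have hgℂ : ContDiff ℝ 1 fun x => (g x : ℂ) := ofRealCLM.contDiff.comp hg
  have hgℂs : HasCompactSupport fun x => (g x : ℂ) := hgs.comp_left Complex.ofReal_zero
  have hg1 : Differentiable ℝ g := hg.differentiable one_ne_zero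
  have hy : τ (toArch hcpt (diagGL2 u 1)) v ∈ archGardingSpace hcpt τ := apply_mem_archGardingSpace hτ _ hv
  conv_lhs => rw [eq_single00_add_single01 h10 h11]
  rw [archDerivE_add_dir hτ (unipSmoothing_mem_archGardingSpace hτ hτb hgℂ.continuous hgℂs hy),
    archDerivE_single00_unipSmoothing hτ hτb hgℂ hgℂs hy (X 0 0), archDerivE_single00_apply_diag hτ hv u (X 0 0),
    archDerivE_single01_unipSmoothing hτ hτb hgℂ hgℂs (X 0 1), neg_fderiv_ofReal_comp hg1]
  congr 2
  refine Finset.sum_congr rfl fun i _ => ?_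
  rw [neg_fderiv_coord_mul_ofReal_comp hg1]

/-- **Pushing one more letter through** (pointwise in `u`): for a `𝔭`-word `w`, a `𝔭`-letter `X`, a
moment kernel `g` of order `≥ M + 1`, `v ∈ 𝒢` and `u ∈ K_∞ˣ`,
`τ(w X) S_U(g) τ(a(u)) v = τ(w) S_U(g) τ(a(u)) τ(E₀₀⊗a) v + Σ_i τ(w) S_U(-∂_{e_i a}(x_i g)) τ(a(u)) v
  + τ(w) S_U(-∂_b g) τ(a(u)) v`. [cite: JacquetShalikaAJM1981, §3, (3.2)–(3.3)] -/
theorem archWordDerivE_append_singleton_unipSmoothing_apply_diag (hτ : τ.IsStronglyContinuous) (hτb : ∀ g, ‖(τ g : E →L[ℂ] E)‖ ≤ 1)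
    (w : List (Matrix (Fin 2) (Fin 2) (mixedSpace K))) {X : Matrix (Fin 2) (Fin 2) (mixedSpace K)} (h10 : X 1 0 = 0) (h11 : X 1 1 = 0)
    {M : ℕ} {g : mixedSpace K → ℝ} (hg : IsMomentKernelGE K (M + 1) g) {v : E} (hv : v ∈ archGardingSpace hcpt τ) (u : (mixedSpace K)ˣ) :
    archWordDerivE hcpt τ (w ++ [X]) (unipSmoothing hcpt τ (fun x => (g x : ℂ)) (τ (toArch hcpt (diagGL2 u 1)) v)) =
      archWordDerivE hcpt τ w (unipSmoothing hcpt τ (fun x => (g x : ℂ)) (τ (toArch hcpt (diagGL2 u 1)) (archDerivE hcpt τ (Matrix.single 0 0 (X 0 0)) v))) +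
        ∑ i, archWordDerivE hcpt τ w (unipSmoothing hcpt τ (fun x => ((coordDerivKernel g i (stdBasis K i * X 0 0) x : ℝ) : ℂ))
          (τ (toArch hcpt (diagGL2 u 1)) v)) +
        archWordDerivE hcpt τ w (unipSmoothing hcpt τ (fun x => ((dirDerivKernel g (X 0 1) x : ℝ) : ℂ)) (τ (toArch hcpt (diagGL2 u 1)) v)) := by
  have hy : τ (toArch hcpt (diagGL2 u 1)) v ∈ archGardingSpace hcpt τ := apply_mem_archGardingSpace hτ _ hv
  have hya : τ (toArch hcpt (diagGL2 u 1)) (archDerivE hcpt τ (Matrix.single 0 0 (X 0 0)) v) ∈ archGardingSpace hcpt τ :=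
    apply_mem_archGardingSpace hτ _ (archDerivE_mem_archGardingSpace hτ _ hv)
  -- memberships of the smoothed vectors, for real kernels
  have hmem : ∀ {g' : mixedSpace K → ℝ} {M' : ℕ} (_ : IsMomentKernelGE K M' g') {y : E} (_ : y ∈ archGardingSpace hcpt τ),
      unipSmoothing hcpt τ (fun x => (g' x : ℂ)) y ∈ archGardingSpace hcpt τ := fun {g'} {M'} hg' {y} hy' =>
    unipSmoothing_mem_archGardingSpace hτ hτb (continuous_ofReal.comp hg'.continuous) (hg'.hasCompactSupport.comp_left Complex.ofReal_zero) hy'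
  rw [archWordDerivE_append [X] _ w, archWordDerivE_cons, archWordDerivE_nil,
    archDerivE_unipSmoothing_apply_diag hτ hτb h10 h11 (hg.contDiff.of_le (by exact_mod_cast le_top)) hg.hasCompactSupport hv u,
    archWordDerivE_add hτ (Submodule.add_mem _ (hmem hg hya) (Submodule.sum_mem _ fun i _ => hmem (hg.coordDerivKernel i _) hy))
      (hmem (hg.dirDerivKernel _) hy) w,
    archWordDerivE_add hτ (hmem hg hya) (Submodule.sum_mem _ fun i _ => hmem (hg.coordDerivKernel i _) hy) w,
    archWordDerivE_finset_sum hτ _ (fun i _ => hmem (hg.coordDerivKernel i _) hy) w]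

variable [MeasurableSpace ((mixedSpace K)ˣ)] [BorelSpace ((mixedSpace K)ˣ)]
  (μ : Measure (mixedSpace K)ˣ) [IsFiniteMeasureOnCompacts μ] [μ.IsMulLeftInvariant]

/-- **`u ↦ τ(w) S_U(g) τ(a(u)) v` is square integrable** for every `𝔭`-word `w`, every moment kernel
`g` of order `≥ |w| + 1` at every place and every `v ∈ 𝒢` (induction on `w` from the right: the
base case is the dilation integral, the step pushes one letter through and loses one order).
[cite: JacquetShalikaAJM1981, §3–§4] -/
theorem memLp_archWordDerivE_unipSmoothing_apply_diag (hτ : τ.IsStronglyContinuous) (hτu : τ.IsUnitary)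
    (w : List (Matrix (Fin 2) (Fin 2) (mixedSpace K))) (hw : ∀ X ∈ w, X 1 0 = 0 ∧ X 1 1 = 0) :
    ∀ {g : mixedSpace K → ℝ} (_ : IsMomentKernelGE K (w.length + 1) g) {v : E} (_ : v ∈ archGardingSpace hcpt τ),
      MemLp (fun u : (mixedSpace K)ˣ => archWordDerivE hcpt τ w (unipSmoothing hcpt τ (fun x => (g x : ℂ)) (τ (toArch hcpt (diagGL2 u 1)) v))) 2 μ := by
  have hτb := norm_apply_le_one_of_isUnitary (hcpt := hcpt) hτu
  induction w using List.reverseRecOn with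
  | nil =>
    intro g hg v _
    exact memLp_unipSmoothing_apply_diag μ hτ hτu hg v
  | append_singleton w X ih =>
    intro g hg v hv
    have hw' : ∀ Y ∈ w, Y 1 0 = 0 ∧ Y 1 1 = 0 := fun Y hY => hw Y (List.mem_append_left _ hY)
    have hX : X 1 0 = 0 ∧ X 1 1 = 0 := hw X (List.mem_append_right _ (List.mem_singleton_self X))
    have hlen : (w ++ [X]).length + 1 = (w.length + 1) + 1 := by simp
    rw [hlen] at hg
    -- the three families after pushing `X` through
    have h₁ : MemLp (fun u : (mixedSpace K)ˣ => archWordDerivE hcpt τ w (unipSmoothing hcpt τ (fun x => (g x : ℂ))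
        (τ (toArch hcpt (diagGL2 u 1)) (archDerivE hcpt τ (Matrix.single 0 0 (X 0 0)) v)))) 2 μ :=
      ih hw' (hg.mono (Nat.le_succ _)) (archDerivE_mem_archGardingSpace hτ _ hv)
    have h₂ : ∀ i, MemLp (fun u : (mixedSpace K)ˣ => archWordDerivE hcpt τ w (unipSmoothing hcpt τ
        (fun x => ((coordDerivKernel g i (stdBasis K i * X 0 0) x : ℝ) : ℂ)) (τ (toArch hcpt (diagGL2 u 1)) v))) 2 μ :=
      fun i => ih hw' (hg.coordDerivKernel i _) hv
    have h₃ : MemLp (fun u : (mixedSpace K)ˣ => archWordDerivE hcpt τ w (unipSmoothing hcpt τ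
        (fun x => ((dirDerivKernel g (X 0 1) x : ℝ) : ℂ)) (τ (toArch hcpt (diagGL2 u 1)) v))) 2 μ :=
      ih hw' ((hg.mono (Nat.le_succ _)).dirDerivKernel _) hv
    have heq : (fun u : (mixedSpace K)ˣ => archWordDerivE hcpt τ (w ++ [X]) (unipSmoothing hcpt τ (fun x => (g x : ℂ)) (τ (toArch hcpt (diagGL2 u 1)) v))) =
        (fun u => archWordDerivE hcpt τ w (unipSmoothing hcpt τ (fun x => (g x : ℂ))
            (τ (toArch hcpt (diagGL2 u 1)) (archDerivE hcpt τ (Matrix.single 0 0 (X 0 0)) v)))) +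
          (fun u => ∑ i, archWordDerivE hcpt τ w (unipSmoothing hcpt τ
            (fun x => ((coordDerivKernel g i (stdBasis K i * X 0 0) x : ℝ) : ℂ)) (τ (toArch hcpt (diagGL2 u 1)) v))) +
          fun u => archWordDerivE hcpt τ w (unipSmoothing hcpt τ (fun x => ((dirDerivKernel g (X 0 1) x : ℝ) : ℂ)) (τ (toArch hcpt (diagGL2 u 1)) v)) := by
      funext u
      simp only [Pi.add_apply]
      exact archWordDerivE_append_singleton_unipSmoothing_apply_diag hτ hτb w hX.1 hX.2 hg hv u
    rw [heq]
    exact (h₁.add (memLp_finsetSum _ fun i _ => h₂ i)).add h₃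

end Push

/-! ### 4. The Kirillov functions of Gårding vectors are in `L²` -/

section Kirillov

variable {hcpt : isCompact_glFiniteIntegralLevel 2 K}
  {E : Type*} [NormedAddCommGroup E] [InnerProductSpace ℂ E] [CompleteSpace E]
  {τ : ContRepresentation ℂ (AutomorphyDatum.gl 2 K hcpt).arch.carrier E}
  [MeasurableSpace ((mixedSpace K)ˣ)] [BorelSpace ((mixedSpace K)ˣ)]
  (μ : Measure (mixedSpace K)ˣ) [IsFiniteMeasureOnCompacts μ] [μ.IsMulLeftInvariant]

/-- **The Kirillov function of a Gårding vector is square integrable** (Jacquet–Shalika (1981),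
(3.16), qualitative half): for an irreducible unitary strongly continuous representation `τ` of
`GL₂(K_∞)` with a continuous Whittaker functional `ℓ`, `W_v ∈ L²(K_∞ˣ, μ)` for every `v ∈ 𝒢` and
every left-invariant Borel measure `μ` on `K_∞ˣ` finite on compacts. [cite: JacquetShalikaAJM1981, §3, (3.16)] -/
theorem memLp_kirillovFn {hτ : τ.IsStronglyContinuous} {ℓ : archGardingSpace hcpt τ →ₗ[ℂ] ℂ}
    (hℓ : IsArchContWhittakerFunctional hcpt τ hτ ℓ) (hτu : τ.IsUnitary) (hτi : τ.IsTopIrreducible)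
    (v : archGardingSpace hcpt τ) : MemLp (kirillovFn hτ ℓ v) 2 μ := by
  have hτb := norm_apply_le_one_of_isUnitary (hcpt := hcpt) hτu
  obtain ⟨C, 𝒮', hC, h𝒮', hbound⟩ := hℓ.norm_le_sum_pWords hτu hτi
  -- a moment kernel of large order with `ĝ₀(1) ≠ 0`
  set L : ℕ := 𝒮'.sup List.length with hL
  obtain ⟨g₀, hg₀, hne⟩ := exists_isMomentKernelGE_kernelTransform_one_ne_zero (K := K) (L + 1)
  have hg₀c : Continuous fun x => (g₀ x : ℂ) := continuous_ofReal.comp hg₀.continuous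
  have hg₀s : HasCompactSupport fun x => (g₀ x : ℂ) := hg₀.hasCompactSupport.comp_left Complex.ofReal_zero
  -- the dominating `L²` function
  set F : List (Matrix (Fin 2) (Fin 2) (mixedSpace K)) → (mixedSpace K)ˣ → E := fun w u =>
    archWordDerivE hcpt τ w (unipSmoothing hcpt τ (fun x => (g₀ x : ℂ)) (τ (toArch hcpt (diagGL2 u 1)) (v : E))) with hF
  have hFw : ∀ w ∈ 𝒮', MemLp (F w) 2 μ := fun w hw =>
    memLp_archWordDerivE_unipSmoothing_apply_diag μ hτ hτu w (h𝒮' w hw)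
      (hg₀.mono (Nat.succ_le_succ (Finset.le_sup (f := List.length) hw))) v.2
  set G : (mixedSpace K)ˣ → ℝ := fun u => ‖kernelTransform K g₀ 1‖⁻¹ * (C * ∑ w ∈ 𝒮', ‖F w u‖) with hG
  have hGm : MemLp G 2 μ := ((memLp_finsetSum _ fun w hw => (hFw w hw).norm).const_mul C).const_mul _
  refine hGm.mono' (continuous_kirillovFn hτ hℓ.norm_le v).aestronglyMeasurable (ae_of_all _ fun u => ?_)
  -- `W_v(u) ĝ₀(1) = ℓ(S_U(g₀) τ(a u) v)` and the `P`-continuity bound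
  have hy : τ (toArch hcpt (diagGL2 u 1)) (v : E) ∈ archGardingSpace hcpt τ := apply_mem_archGardingSpace hτ _ v.2
  have hins := apply_unipSmoothing_eq hτb hℓ hg₀c hg₀s hy
  have hkt : (∫ x, (g₀ x : ℂ) * archChar K 1 x) = kernelTransform K g₀ 1 := rfl
  rw [hkt] at hins
  have hW : kirillovFn hτ ℓ v u = (kernelTransform K g₀ 1)⁻¹ *
      ℓ ⟨unipSmoothing hcpt τ (fun x => (g₀ x : ℂ)) (τ (toArch hcpt (diagGL2 u 1)) (v : E)),
        unipSmoothing_mem_archGardingSpace hτ hτb hg₀c hg₀s hy⟩ := by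
    rw [hins, ← mul_assoc, inv_mul_cancel₀ hne, one_mul]
    rfl
  change ‖kirillovFn hτ ℓ v u‖ ≤ ‖kernelTransform K g₀ 1‖⁻¹ * (C * ∑ w ∈ 𝒮', ‖F w u‖)
  rw [hW, norm_mul, norm_inv]
  exact mul_le_mul_of_nonneg_left (hbound _) (inv_nonneg.2 (norm_nonneg _))

end Kirillov

end SoftBound

/-! ## Part C. The Kirillov map is bounded (closable intertwiner + Schur) -/

section Closable

attribute [local instance] glInfBorel borelSpace_glInf locallyCompactSpace_glInf secondCountableTopology_glInf


/-! ### 1. Functions in `L²(K_∞ˣ)` orthogonal to all torus kernels vanish -/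

section Total

/-- The character form is symmetric: `B(ξ, x) = B(x, ξ)`. [folklore] -/
theorem archCharForm_comm (ξ x : mixedSpace K) : archCharForm K ξ x = archCharForm K x ξ := by
  rw [archCharForm_apply, archCharForm_apply, mul_comm ξ x]

/-- `z ↦ ψ_∞(z x)` is smooth. [folklore] -/
theorem contDiff_archChar_left (x : mixedSpace K) : ContDiff ℝ ∞ fun z : mixedSpace K => archChar K z x := by
  have h : (fun z : mixedSpace K => archChar K z x) = archChar K x := by
    funext z; unfold archChar; rw [archCharForm_comm]
  rw [h, archChar_eq]
  exact Complex.contDiff_exp.comp (archCharExpCLM K x).contDiff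

/-- **Torus kernels twisted by characters are torus kernels.** [folklore] -/
theorem IsTorusKernel.archChar_mul {φ : mixedSpace K → ℂ} (hφ : IsTorusKernel K φ) (x : mixedSpace K) :
    IsTorusKernel K (fun z => archChar K z x * φ z) :=
  hφ.mul_left (contDiff_archChar_left x)

variable [MeasurableSpace ((mixedSpace K)ˣ)] [BorelSpace ((mixedSpace K)ˣ)]
  (μ : Measure (mixedSpace K)ˣ) [IsFiniteMeasureOnCompacts μ]

/-- The restriction of a torus kernel to `K_∞ˣ` is in every `L^p(μ)`. [folklore] -/
theorem IsTorusKernel.memLp_comp_val {φ : mixedSpace K → ℂ} (hφ : IsTorusKernel K φ) (p : ℝ≥0∞) :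
    MemLp (fun u : (mixedSpace K)ˣ => φ (u : mixedSpace K)) p μ :=
  (hφ.continuous.comp Units.continuous_val).memLp_of_hasCompactSupport hφ.hasCompactSupport_comp_val

/-- The conjugate restriction of a torus kernel is in every `L^p(μ)`. [folklore] -/
theorem IsTorusKernel.memLp_conj_comp_val {φ : mixedSpace K → ℂ} (hφ : IsTorusKernel K φ) (p : ℝ≥0∞) :
    MemLp (fun u : (mixedSpace K)ˣ => conj (φ (u : mixedSpace K))) p μ :=
  (continuous_conj.comp (hφ.continuous.comp Units.continuous_val)).memLp_of_hasCompactSupport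
    (hφ.hasCompactSupport_comp_val.comp_left (g := fun z : ℂ => conj z) (map_zero _))

/-- **The pairing with a torus kernel is an inner product on `L²`**: `∫ φ f dμ = ⟪\bar φ, f⟫`.
[folklore] -/
theorem integral_isTorusKernel_mul_eq_inner {φ : mixedSpace K → ℂ} (hφ : IsTorusKernel K φ) (f : Lp ℂ 2 μ) :
    ∫ u : (mixedSpace K)ˣ, φ (u : mixedSpace K) * f u ∂μ = ⟪(hφ.memLp_conj_comp_val μ 2).toLp _, f⟫_ℂ := by
  rw [inner_Lp_eq_integral]
  refine integral_congr_ae ?_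
  filter_upwards [(hφ.memLp_conj_comp_val μ 2).coeFn_toLp] with u hu
  rw [hu, Complex.conj_conj]

/-- **A function in `L²(K_∞ˣ, μ)` orthogonal to all torus kernels is zero**: twist the kernels by the
characters `ψ_∞(· x)` and apply Fourier uniqueness on `K_∞ˣ` (`ae_eq_zero_of_forall_integral_archChar_mul`)
to get `φ y = 0` a.e. for every torus kernel `φ`; torus kernels equal to `1` near any given unit exist,
and countably many such neighbourhoods cover `K_∞ˣ`. [folklore] -/
theorem Lp_eq_zero_of_forall_isTorusKernel (y : Lp ℂ 2 μ)
    (h : ∀ φ : mixedSpace K → ℂ, IsTorusKernel K φ → ∫ u : (mixedSpace K)ˣ, φ (u : mixedSpace K) * y u ∂μ = 0) : y = 0 := by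
  -- `φ y = 0` a.e. for every torus kernel
  have hφy : ∀ φ : mixedSpace K → ℂ, IsTorusKernel K φ → ∀ᵐ u : (mixedSpace K)ˣ ∂μ, φ (u : mixedSpace K) * y u = 0 := by
    intro φ hφ
    have hint : Integrable (fun u : (mixedSpace K)ˣ => φ (u : mixedSpace K) * y u) μ :=
      (hφ.memLp_comp_val μ 2).integrable_mul (Lp.memLp y)
    have h0 := ae_eq_zero_of_forall_integral_archChar_mul μ hint fun x => by
      have h1 := h _ (hφ.archChar_mul x)
      rw [← h1]
      exact integral_congr_ae (Eventually.of_forall fun u => by simp only [mul_assoc])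
    filter_upwards [h0] with u hu
    simpa using hu
  -- bumps around every unit and a countable subcover
  choose φ hφ hφ1 using fun u₀ : (mixedSpace K)ˣ => exists_isTorusKernel_eventually_eq_one (K := K) u₀
  obtain ⟨s, hs, hcover⟩ := TopologicalSpace.countable_cover_nhds (f := fun u₀ : (mixedSpace K)ˣ => {u : (mixedSpace K)ˣ | φ u₀ (u : mixedSpace K) = 1})
    fun u₀ => hφ1 u₀
  refine Lp.eq_zero_iff_ae_eq_zero.2 ?_
  rw [EventuallyEq, ae_iff]
  have hsub : {u : (mixedSpace K)ˣ | ¬ y u = (0 : (mixedSpace K)ˣ → ℂ) u} ⊆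
      ⋃ u₀ ∈ s, ({u : (mixedSpace K)ˣ | φ u₀ (u : mixedSpace K) = 1} ∩ {u : (mixedSpace K)ˣ | ¬ y u = 0}) := by
    intro u hu
    have hu' : u ∈ ⋃ u₀ ∈ s, {u : (mixedSpace K)ˣ | φ u₀ (u : mixedSpace K) = 1} := by rw [hcover]; exact mem_univ u
    obtain ⟨u₀, hu₀, hmem⟩ := mem_iUnion₂.1 hu'
    exact mem_iUnion₂.2 ⟨u₀, hu₀, hmem, hu⟩
  refine measure_mono_null hsub ((measure_biUnion_null_iff hs).2 fun u₀ _ => ?_)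
  have hae := hφy (φ u₀) (hφ u₀)
  rw [ae_iff] at hae
  refine measure_mono_null (fun u hu => ?_) hae
  obtain ⟨h1, h2⟩ := hu
  change ¬ (φ u₀ (u : mixedSpace K) * y u = 0)
  rw [show φ u₀ (u : mixedSpace K) = 1 from h1, one_mul]
  exact h2

end Total

/-! ### 2. The restriction of `τ` to the mirabolic subgroup and the graph of the Kirillov map -/

section Graph

variable {hcpt : isCompact_glFiniteIntegralLevel 2 K}
  {E : Type*} [NormedAddCommGroup E] [InnerProductSpace ℂ E] [CompleteSpace E]
  {τ : ContRepresentation ℂ (AutomorphyDatum.gl 2 K hcpt).arch.carrier E}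

variable (hcpt) in
/-- The inclusion `P₂(K_∞) → G_∞`. [folklore] -/
def mirabolicIncl : mirabolicTwo K →* (AutomorphyDatum.gl 2 K hcpt).arch.carrier where
  toFun p := toArch hcpt (p : GL (Fin 2) (mixedSpace K))
  map_one' := rfl
  map_mul' _ _ := rfl

variable (hcpt τ) in
/-- **`τ` restricted to the mirabolic subgroup `P₂(K_∞)`.** [cite: JacquetShalikaAJM1981, §3, (3.5)] -/
def mirabolicRep : ContRepresentation ℂ (mirabolicTwo K) E := τ.restrict (mirabolicIncl hcpt)

omit [CompleteSpace E] in
/-- Unfolding of `mirabolicRep`. [folklore] -/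
@[simp] theorem mirabolicRep_apply (p : mirabolicTwo K) (v : E) :
    mirabolicRep hcpt τ p v = τ (toArch hcpt (p : GL (Fin 2) (mixedSpace K))) v := rfl

/-- The restriction of a unitary representation is unitary. [folklore] -/
theorem isUnitary_mirabolicRep (hτu : τ.IsUnitary) : (mirabolicRep hcpt τ).IsUnitary := fun _ => hτu _

variable [MeasurableSpace ((mixedSpace K)ˣ)] [BorelSpace ((mixedSpace K)ˣ)]
  (μ : Measure (mixedSpace K)ˣ) [IsFiniteMeasureOnCompacts μ] [μ.IsMulLeftInvariant]
  {hτ : τ.IsStronglyContinuous} {ℓ : archGardingSpace hcpt τ →ₗ[ℂ] ℂ}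

/-- **The Kirillov map** `v ↦ W_v ∈ L²(K_∞ˣ, μ)` on the Gårding space (`memLp_kirillovFn`).
[cite: JacquetShalikaAJM1981, §3, (3.16)] -/
def kirillovLp (hℓ : IsArchContWhittakerFunctional hcpt τ hτ ℓ) (hτu : τ.IsUnitary) (hτi : τ.IsTopIrreducible)
    (v : archGardingSpace hcpt τ) : Lp ℂ 2 μ :=
  (memLp_kirillovFn μ hℓ hτu hτi v).toLp (kirillovFn hτ ℓ v)

variable (hℓ : IsArchContWhittakerFunctional hcpt τ hτ ℓ) (hτu : τ.IsUnitary) (hτi : τ.IsTopIrreducible)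

/-- `kirillovLp v = W_v` almost everywhere. [folklore] -/
theorem coeFn_kirillovLp (v : archGardingSpace hcpt τ) : kirillovLp μ hℓ hτu hτi v =ᵐ[μ] kirillovFn hτ ℓ v :=
  MemLp.coeFn_toLp _

/-- The Kirillov map is additive. [folklore] -/
theorem kirillovLp_add (v v' : archGardingSpace hcpt τ) :
    kirillovLp μ hℓ hτu hτi (v + v') = kirillovLp μ hℓ hτu hτi v + kirillovLp μ hℓ hτu hτi v' := by
  unfold kirillovLp
  rw [← MemLp.toLp_add]
  exact MemLp.toLp_congr _ _ (Eventually.of_forall fun u => by rw [kirillovFn_add])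

/-- The Kirillov map is homogeneous. [folklore] -/
theorem kirillovLp_smul (c : ℂ) (v : archGardingSpace hcpt τ) :
    kirillovLp μ hℓ hτu hτi (c • v) = c • kirillovLp μ hℓ hτu hτi v := by
  unfold kirillovLp
  rw [← MemLp.toLp_const_smul]
  exact MemLp.toLp_congr _ _ (Eventually.of_forall fun u => by rw [kirillovFn_smul])

/-- The Kirillov map with its graph embedding `v ↦ (v, W_v)`, a linear map `𝒢 → E × L²`. [folklore] -/
def kirillovGraphMap : archGardingSpace hcpt τ →ₗ[ℂ] E × Lp ℂ 2 μ where
  toFun v := ((v : E), kirillovLp μ hℓ hτu hτi v)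
  map_add' v v' := Prod.ext rfl (kirillovLp_add μ hℓ hτu hτi v v')
  map_smul' c v := Prod.ext rfl (kirillovLp_smul μ hℓ hτu hτi c v)

/-- **The graph `Γ = {(v, W_v) : v ∈ 𝒢}` of the Kirillov map.** [cite: JacquetShalikaAJM1981, §3, (3.16)] -/
def kirillovGraph : Submodule ℂ (E × Lp ℂ 2 μ) := LinearMap.range (kirillovGraphMap μ hℓ hτu hτi)

/-- Membership in the graph. [folklore] -/
theorem mem_kirillovGraph_iff {x : E × Lp ℂ 2 μ} :
    x ∈ kirillovGraph μ hℓ hτu hτi ↔ ∃ v : archGardingSpace hcpt τ, ((v : E), kirillovLp μ hℓ hτu hτi v) = x :=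
  LinearMap.mem_range

/-- **Covariance of the Kirillov map under the mirabolic subgroup**: `W_{τ(p) v} = ρ(p) W_v` in `L²`.
[cite: JacquetShalikaAJM1981, §3, (3.5)] -/
theorem kirillovLp_mirabolic (p : mirabolicTwo K) (v : archGardingSpace hcpt τ) :
    kirillovLp μ hℓ hτu hτi ⟨τ (toArch hcpt (p : GL (Fin 2) (mixedSpace K))) v, apply_mem_archGardingSpace hτ _ v.2⟩ =
      kirillovRep μ p (kirillovLp μ hℓ hτu hτi v) := by
  refine Lp.ext ?_
  have hcomp : (fun u => (kirillovLp μ hℓ hτu hτi v : (mixedSpace K)ˣ → ℂ) (u * mirabolicFst p)) =ᵐ[μ]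
      fun u => kirillovFn hτ ℓ v (u * mirabolicFst p) :=
    (measurePreserving_mul_right μ (mirabolicFst p)).quasiMeasurePreserving.ae_eq_comp (coeFn_kirillovLp μ hℓ hτu hτi v)
  filter_upwards [coeFn_kirillovLp μ hℓ hτu hτi ⟨τ (toArch hcpt (p : GL (Fin 2) (mixedSpace K))) v, apply_mem_archGardingSpace hτ _ v.2⟩,
    coeFn_kirillovRep μ p (kirillovLp μ hℓ hτu hτi v), hcomp] with u h1 h2 h3
  rw [h1, h2, kirillovFn_toArch_mirabolic hℓ p v u, h3]

/-- **The graph is invariant** under `(τ(p), ρ(p))`, `p ∈ P₂`. [folklore] -/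
theorem kirillovGraph_invariant (p : mirabolicTwo K) {x : E × Lp ℂ 2 μ} (hx : x ∈ kirillovGraph μ hℓ hτu hτi) :
    (mirabolicRep hcpt τ p x.1, kirillovRep μ p x.2) ∈ kirillovGraph μ hℓ hτu hτi := by
  obtain ⟨v, rfl⟩ := (mem_kirillovGraph_iff μ hℓ hτu hτi).1 hx
  exact (mem_kirillovGraph_iff μ hℓ hτu hτi).2
    ⟨⟨τ (toArch hcpt (p : GL (Fin 2) (mixedSpace K))) v, apply_mem_archGardingSpace hτ _ v.2⟩,
      Prod.ext rfl (kirillovLp_mirabolic μ hℓ hτu hτi p v)⟩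

/-- **The closure of the graph is a graph**: if `(0, y)` lies in the closure of `Γ` then `y = 0`
(the adjoint vectors `\bar φ`, `φ` a torus kernel, are total). [cite: JacquetShalikaAJM1981, §3, (3.16)] -/
theorem eq_zero_of_mem_closure_kirillovGraph (y : Lp ℂ 2 μ)
    (hy : ((0 : E), y) ∈ (kirillovGraph μ hℓ hτu hτi).topologicalClosure) : y = 0 := by
  rw [← SetLike.mem_coe, Submodule.topologicalClosure_coe] at hy
  obtain ⟨x, hxΓ, hlim⟩ := mem_closure_iff_seq_limit.1 hy
  choose v hv using fun n => (mem_kirillovGraph_iff μ hℓ hτu hτi).1 (hxΓ n)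
  have hv1 : Tendsto (fun n => ((v n : archGardingSpace hcpt τ) : E)) atTop (𝓝 0) := by
    have h := (continuous_fst.tendsto _).comp hlim
    refine h.congr fun n => ?_
    change (x n).1 = _
    rw [← hv n]
  have hv2 : Tendsto (fun n => kirillovLp μ hℓ hτu hτi (v n)) atTop (𝓝 y) := by
    have h := (continuous_snd.tendsto _).comp hlim
    refine h.congr fun n => ?_
    change (x n).2 = _
    rw [← hv n]
  refine Lp_eq_zero_of_forall_isTorusKernel μ y fun φ hφ => ?_
  -- the pairing with `φ` along the sequence
  set hφL : Lp ℂ 2 μ := (hφ.memLp_conj_comp_val μ 2).toLp _ with hhφL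
  have hlim1 : Tendsto (fun n => ⟪hφL, kirillovLp μ hℓ hτu hτi (v n)⟫_ℂ) atTop (𝓝 ⟪hφL, y⟫_ℂ) :=
    ((continuous_const.inner continuous_id).tendsto y).comp hv2
  have hlim0 : Tendsto (fun n => ⟪hφL, kirillovLp μ hℓ hτu hτi (v n)⟫_ℂ) atTop (𝓝 0) := by
    obtain ⟨C, hC⟩ := exists_norm_integral_mul_kirillovFn_le μ hℓ hτu hτi hφ
    have hbound : ∀ n, ‖⟪hφL, kirillovLp μ hℓ hτu hτi (v n)⟫_ℂ‖ ≤ ‖C‖ * ‖((v n : archGardingSpace hcpt τ) : E)‖ := by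
      intro n
      rw [hhφL, ← integral_isTorusKernel_mul_eq_inner μ hφ]
      have heq : ∫ u : (mixedSpace K)ˣ, φ (u : mixedSpace K) * (kirillovLp μ hℓ hτu hτi (v n) : (mixedSpace K)ˣ → ℂ) u ∂μ =
          ∫ u, φ (u : mixedSpace K) * kirillovFn hτ ℓ (v n) u ∂μ := by
        refine integral_congr_ae ?_
        filter_upwards [coeFn_kirillovLp μ hℓ hτu hτi (v n)] with u hu
        rw [hu]
      rw [heq]
      exact (hC (v n)).trans (mul_le_mul_of_nonneg_right (Real.le_norm_self C) (norm_nonneg _))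
    refine squeeze_zero_norm hbound ?_
    simpa using hv1.norm.const_mul ‖C‖
  have h0 : ⟪hφL, y⟫_ℂ = 0 := tendsto_nhds_unique hlim1 hlim0
  rw [integral_isTorusKernel_mul_eq_inner μ hφ, ← hhφL, h0]

end Graph

/-! ### 3. The bound -/

section Bound

variable {hcpt : isCompact_glFiniteIntegralLevel 2 K}
  {E : Type*} [NormedAddCommGroup E] [InnerProductSpace ℂ E] [CompleteSpace E]
  {τ : ContRepresentation ℂ (AutomorphyDatum.gl 2 K hcpt).arch.carrier E}
  [MeasurableSpace ((mixedSpace K)ˣ)] [BorelSpace ((mixedSpace K)ˣ)]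
  {hτ : τ.IsStronglyContinuous} {ℓ : archGardingSpace hcpt τ →ₗ[ℂ] ℂ}

/-- **The Kirillov map is bounded**: `‖W_v‖_{L²(μ)} ≤ C ‖v‖` on the Gårding space, for a Haar measure
`μ` on `K_∞ˣ` (closable invariant graph into the Kirillov representation, which has the Schur
property; `ContRepresentation.exists_norm_snd_le_of_invariant_of_schur`).
[cite: JacquetShalikaAJM1981, §3, (3.16)] [cite: WallachRRG1, 1.2.2] -/
theorem exists_norm_kirillovLp_le (μ : Measure (mixedSpace K)ˣ) [μ.IsHaarMeasure]
    (hℓ : IsArchContWhittakerFunctional hcpt τ hτ ℓ) (hτu : τ.IsUnitary) (hτi : τ.IsTopIrreducible) :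
    ∃ C : ℝ, 0 ≤ C ∧ ∀ v : archGardingSpace hcpt τ, ‖kirillovLp μ hℓ hτu hτi v‖ ≤ C * ‖(v : E)‖ := by
  obtain ⟨C, hC, h⟩ := ContRepresentation.exists_norm_snd_le_of_invariant_of_schur (isUnitary_mirabolicRep hτu)
    (isUnitary_kirillovRep μ) (kirillovRep_schur μ) (kirillovGraph μ hℓ hτu hτi)
    (fun p x hx => kirillovGraph_invariant μ hℓ hτu hτi p hx) (eq_zero_of_mem_closure_kirillovGraph μ hℓ hτu hτi)
  exact ⟨C, hC, fun v => h ((v : E), kirillovLp μ hℓ hτu hτi v) ((mem_kirillovGraph_iff μ hℓ hτu hτi).2 ⟨v, rfl⟩)⟩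

omit [NumberField K] [BorelSpace ((mixedSpace K)ˣ)] in
/-- `∫ ‖f‖² dμ = ‖f‖²_{L²}` in `ℝ≥0∞`. [folklore] -/
theorem lintegral_enorm_sq_eq_eLpNorm_sq (μ : Measure (mixedSpace K)ˣ) (f : (mixedSpace K)ˣ → ℂ) : ∫⁻ u, ‖f u‖ₑ ^ 2 ∂μ = eLpNorm f 2 μ ^ 2 := by
  have h := eLpNorm_nnreal_pow_eq_lintegral (f := f) (μ := μ) (p := (2 : ℝ≥0)) two_ne_zero
  rw [ENNReal.coe_ofNat, NNReal.coe_ofNat] at h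
  simp only [ENNReal.rpow_two] at h
  exact h.symm

/-- **`∫ |W_v|² dμ ≤ C ‖v‖²` with `C < ∞`** for a Haar measure `μ` on `K_∞ˣ` and all `v ∈ 𝒢`.
[cite: JacquetShalikaAJM1981, §3, (3.16)] -/
theorem exists_lintegral_enorm_sq_kirillovFn_le (μ : Measure (mixedSpace K)ˣ) [μ.IsHaarMeasure]
    (hℓ : IsArchContWhittakerFunctional hcpt τ hτ ℓ) (hτu : τ.IsUnitary) (hτi : τ.IsTopIrreducible) :
    ∃ C : ℝ≥0∞, C ≠ ⊤ ∧ ∀ v : archGardingSpace hcpt τ, ∫⁻ u, ‖kirillovFn hτ ℓ v u‖ₑ ^ 2 ∂μ ≤ C * ‖(v : E)‖ₑ ^ 2 := by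
  obtain ⟨C, hC, h⟩ := exists_norm_kirillovLp_le μ hℓ hτu hτi
  refine ⟨ENNReal.ofReal (C ^ 2), ENNReal.ofReal_ne_top, fun v => ?_⟩
  have hmem := memLp_kirillovFn μ hℓ hτu hτi v
  have hnorm : eLpNorm (kirillovFn hτ ℓ v) 2 μ = ENNReal.ofReal ‖kirillovLp μ hℓ hτu hτi v‖ := by
    rw [kirillovLp, Lp.norm_toLp, ENNReal.ofReal_toReal hmem.eLpNorm_ne_top]
  rw [lintegral_enorm_sq_eq_eLpNorm_sq, hnorm, ← ofReal_norm, ← ENNReal.ofReal_pow (norm_nonneg _),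
    ← ENNReal.ofReal_pow (norm_nonneg _), ← ENNReal.ofReal_mul (sq_nonneg _), ← mul_pow]
  exact ENNReal.ofReal_le_ofReal (pow_le_pow_left₀ (norm_nonneg _) (h v) 2)

end Bound

end Closable

/-! ## Part D. Transport to the named fact in rank two -/

section NormLeOne

attribute [local instance] locallyCompactSpace_glInf secondCountableTopology_glInf


/-! ### 1. The group elements `diag(y k, 1)` -/

/-- The unit `det k ∈ K_∞ˣ` of `k ∈ K_1 ⊆ GL₁(K_∞)`. [folklore] -/
def kinfOneUnit (k : ↥(Kinf 1 K)) : (mixedSpace K)ˣ := Matrix.GeneralLinearGroup.det (k : GL (Fin 1) (mixedSpace K))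

/-- `↑(det k) = k₀₀`. [folklore] -/
theorem coe_kinfOneUnit (k : ↥(Kinf 1 K)) :
    ((kinfOneUnit k : (mixedSpace K)ˣ) : mixedSpace K) = ((k : GL (Fin 1) (mixedSpace K)) : Matrix (Fin 1) (Fin 1) (mixedSpace K)) 0 0 := by
  rw [kinfOneUnit, Matrix.GeneralLinearGroup.val_det_apply, Matrix.det_fin_one]

/-- `k ↦ det k` is continuous on `K_1`. [folklore] -/
theorem continuous_kinfOneUnit : Continuous (kinfOneUnit (K := K)) :=
  Matrix.GeneralLinearGroup.continuous_det.comp continuous_subtype_val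

/-- **`diag(diag(y) k, 1) = a(y₀ det k)`** in `GL₂(K_∞)` for `y ∈ (K_∞ˣ)^1`, `k ∈ K_1`. [folklore] -/
theorem cornerSucc_glDiagonal_one_mul (y : Fin 1 → (mixedSpace K)ˣ) (k : ↥(Kinf 1 K)) :
    GLn.cornerSucc (mixedSpace K) (glDiagonal 1 (mixedSpace K) y * (k : GL (Fin 1) (mixedSpace K))) =
      diagGL2 (y 0 * kinfOneUnit k) 1 := by
  refine Units.ext ?_
  rw [GLn.coe_cornerSucc, coe_diagGL2, Units.val_mul, coe_glDiagonal]
  set A : Matrix (Fin 1) (Fin 1) (mixedSpace K) := (Matrix.diagonal fun i => ((y i : (mixedSpace K)ˣ) : mixedSpace K)) *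
    ((k : GL (Fin 1) (mixedSpace K)) : Matrix (Fin 1) (Fin 1) (mixedSpace K)) with hA
  have h00 : A 0 0 = ((y 0 * kinfOneUnit k : (mixedSpace K)ˣ) : mixedSpace K) := by
    rw [hA, Matrix.diagonal_mul, Units.val_mul, coe_kinfOneUnit]
  refine Matrix.ext fun i j => ?_
  fin_cases i <;> fin_cases j
  · change cornerSuccMatrix A (Fin.castSucc (0 : Fin 1)) (Fin.castSucc (0 : Fin 1)) = _
    rw [cornerSuccMatrix_apply_castSucc_castSucc, h00]
    rfl
  · change cornerSuccMatrix A (Fin.castSucc (0 : Fin 1)) (Fin.last 1) = _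
    rw [cornerSuccMatrix_apply_castSucc_last]
    rfl
  · change cornerSuccMatrix A (Fin.last 1) (Fin.castSucc (0 : Fin 1)) = _
    rw [cornerSuccMatrix_apply_last_castSucc]
    rfl
  · change cornerSuccMatrix A (Fin.last 1) (Fin.last 1) = _
    rw [cornerSuccMatrix_apply_last_last]
    rfl

/-- **The torus weight is `1` in rank one** at `σ = 0`. [folklore] -/
theorem archTorusWeight_one_zero (y : Fin 1 → (mixedSpace K)ˣ) : archTorusWeight 1 K 0 y = 1 := by
  rw [archTorusWeight, Fin.prod_univ_one]
  norm_num

/-! ### 2. Instances on `(K_∞ˣ)^1` and `K_1` -/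

section Instances

variable [MeasurableSpace ((mixedSpace K)ˣ)] [BorelSpace ((mixedSpace K)ˣ)]

/-- The Borel structure of `(K_∞ˣ)ⁿ`. [folklore] -/
private theorem borelSpace_pi_mixedUnits'' (n : ℕ) : BorelSpace (Fin n → (mixedSpace K)ˣ) := by
  haveI hB : BorelSpace ((mixedSpace K)ˣ) := inferInstance
  haveI hS : SecondCountableTopology ((mixedSpace K)ˣ) := inferInstance
  exact @Pi.borelSpace (Fin n) (fun _ => (mixedSpace K)ˣ) _ _ _ (fun _ => hS) (fun _ => hB)

omit [NumberField K] in
/-- Measurability of the multiplication of `K_∞ˣ`. [folklore] -/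
private theorem measurableMul_mixedUnits''' : MeasurableMul ((mixedSpace K)ˣ) := ContinuousMul.measurableMul

end Instances

attribute [local instance] borelSpace_pi_mixedUnits'' measurableMul_mixedUnits'''

/-! ### 3. The bound -/

/-- **Jacquet–Shalika's Kirillov bound for `GL₂(K_∞)`** (discharge of the rank-two case `m = 1` of
`JacquetShalika1981_archKirillovNorm_le`): for an irreducible unitary strongly continuous representation
of `GL₂(K_∞)` on a Hilbert space with a continuous Whittaker functional `ℓ`, and Haar measures `μ'` on
`(K_∞ˣ)^1`, `μK'` on `K_1`, there is `c < ∞` with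
`∫ |ℓ(τ(diag(y k, 1)) v)|² d(μ' × μK') ≤ c ‖v‖²` for every Gårding vector `v`.
[cite: JacquetShalikaAJM1981, (3.16) Proposition, p. 542, with Prop. (3.8) p. 522] -/
theorem JacquetShalika1981_archKirillovNorm_le_one (K : Type) [Field K] [NumberField K] :
    JacquetShalika1981_archKirillovNorm_le 1 K := by
  intro _ hcpt E _ _ _ τ hτ hτu hτi ℓ hℓ _ _ _ _ μ' hμ' μK' hμK'
  haveI := hμ'
  haveI := hμK'
  haveI : CompactSpace ↥(Kinf 1 K) := isCompact_iff_compactSpace.1 (isCompact_Kinf_holds 1 K)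
  -- the Haar measure `ν` on `K_∞ˣ` image of `μ'` under `y ↦ y 0`
  set eM : (Fin 1 → (mixedSpace K)ˣ) ≃ᵐ (mixedSpace K)ˣ := MeasurableEquiv.funUnique (Fin 1) ((mixedSpace K)ˣ) with heM
  set ν : Measure (mixedSpace K)ˣ := Measure.map eM μ' with hν
  haveI hνH : ν.IsHaarMeasure := by
    have h := MulEquiv.isHaarMeasure_map μ' (MulEquiv.funUnique (Fin 1) ((mixedSpace K)ˣ)) (continuous_apply _)
      (continuous_pi fun _ => continuous_id)
    have hcoe : (⇑(MulEquiv.funUnique (Fin 1) ((mixedSpace K)ˣ)) : (Fin 1 → (mixedSpace K)ˣ) → (mixedSpace K)ˣ) = eM :=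
      funext fun _ => rfl
    rw [hcoe] at h
    rw [hν]
    exact h
  -- the `L²` bound on `K_∞ˣ`
  obtain ⟨C, hC, hbound⟩ := exists_lintegral_enorm_sq_kirillovFn_le ν hℓ hτu hτi
  refine ⟨C * μK' univ, ENNReal.mul_ne_top hC (measure_ne_top _ _), fun v => ?_⟩
  -- the integrand is `|W_v(y₀ det k)|²`
  set u : (Fin 1 → (mixedSpace K)ˣ) × ↥(Kinf 1 K) → (mixedSpace K)ˣ := fun p => p.1 0 * kinfOneUnit p.2 with hu
  set F : (mixedSpace K)ˣ → ℝ≥0∞ := fun w => ‖kirillovFn hτ ℓ v w‖ₑ ^ 2 with hF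
  have hpt : ∀ p : (Fin 1 → (mixedSpace K)ˣ) × ↥(Kinf 1 K),
      ‖ℓ ⟨τ (toArch hcpt (GLn.cornerSucc (mixedSpace K)
          (glDiagonal 1 (mixedSpace K) p.1 * (p.2 : GL (Fin 1) (mixedSpace K))))) (v : E),
        apply_mem_archGardingSpace hτ _ v.2⟩‖ₑ ^ 2 * ENNReal.ofReal (archTorusWeight 1 K 0 p.1) = F (u p) := by
    intro p
    have hx : (⟨τ (toArch hcpt (GLn.cornerSucc (mixedSpace K)
          (glDiagonal 1 (mixedSpace K) p.1 * (p.2 : GL (Fin 1) (mixedSpace K))))) (v : E),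
        apply_mem_archGardingSpace hτ _ v.2⟩ : archGardingSpace hcpt τ) =
        ⟨τ (toArch hcpt (diagGL2 (u p) 1)) (v : E), apply_mem_archGardingSpace hτ _ v.2⟩ :=
      Subtype.ext (by rw [cornerSucc_glDiagonal_one_mul])
    rw [archTorusWeight_one_zero, ENNReal.ofReal_one, mul_one, hx]
    rfl
  simp_rw [hpt]
  -- swap the factors and integrate first over `y`
  have hswap : μ'.prod μK' = Measure.map (MeasurableEquiv.prodComm : ↥(Kinf 1 K) × (Fin 1 → (mixedSpace K)ˣ) ≃ᵐ _) (μK'.prod μ') :=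
    (Measure.prod_swap (μ := μK') (ν := μ')).symm
  rw [hswap, lintegral_map_equiv]
  refine (lintegral_prod_le _).trans ?_
  -- the inner integral is `∫ F dν` for every `k`
  have hinner : ∀ k : ↥(Kinf 1 K), ∫⁻ y, F (u (MeasurableEquiv.prodComm (k, y))) ∂μ' = ∫⁻ w, F w ∂ν := by
    intro k
    have h1 : ∫⁻ w, F (w * kinfOneUnit k) ∂ν = ∫⁻ y, F (eM y * kinfOneUnit k) ∂μ' := by
      rw [hν]; exact lintegral_map_equiv (fun w => F (w * kinfOneUnit k)) eM
    rw [← lintegral_mul_right_eq_self F (kinfOneUnit k), h1]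
    rfl
  simp_rw [hinner]
  rw [lintegral_const, mul_comm (∫⁻ w, F w ∂ν) (μK' univ), mul_comm C (μK' univ), mul_assoc]
  exact mul_le_mul_right (hbound v) _

end NormLeOne

end Literature.NumberTheory.Automorphic
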